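import Literature.AlgebraicGeometry.Kawanoue2007.SupportingLemmas
import Literature.AlgebraicGeometry.Kawanoue2007.WeakOrderMuTilde
import Literature.AlgebraicGeometry.Kawanoue2007.IdealisticFiltrationSaturation
import Literature.AlgebraicGeometry.Resolution.HasseSystemRegularParameters
import Mathlib.Data.Nat.Choose.Lucas
import HarnessLib

/-!
# Kawanoue 2007, Part I, §4.1.3–§4.1.4: the Coefficient Lemma (Lemma 4.1.4.1) — PROVED

H. Kawanoue, *Toward resolution of singularities over a field of positive characteristic. Part I.
Foundation; the language of the idealistic filtration*, Publ. RIMS **43** (2007) 819–909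
(= arXiv:math/0607009) [Kawanoue2007], §4.1.3 «Setting for the coefficient lemma» and §4.1.4 «Statement and
proof of the coefficient lemma» (held arXiv text, `lit read paper:arxiv-math-0607009`, chunks p0090 L31 – p0093 L20;
locators = chunk:line, re-read for this file). Sequel of `SupportingLemmas.lean` (Lemma 4.1.2.3) and
`Resolution/HasseSystemRegularParameters.lean` (the operators `∂_{x^J}`); campaign `res-hironaka` (D-0089), rung
LIT-6, seat res-lit-2, bricks (c)–(d) of `HOME/lit/res-lit-2/SIZING-IFP-Ch4.md`. The Coefficient Lemma is the
common engine of Thm. 4.2.1.1 (the nonsingularity principle; tree facts `Kawanoue2007_thm_4_2_1_1(_generate)`,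
`NonsingularityPrinciple.lean`) and of Kawanoue–Matsuki 2010 Prop. 3.1.2.1 (`KawanoueMatsuki2010_prop_3_1_2_1`).
NO named fact is introduced (net debt 0): definitions with bodies and theorems only. Nothing of H. Hironaka's 2017
manuscript is referred to or asserted. AI-written; AI review is weaker than expert review.

## What is printed (locators)

* Setting 4.1.3 (p0090 L33 – p0091 L2): «Let `𝕀` be a 𝔇-saturated idealistic filtration over `R`. Let
  `ℋ = {h_1, …, h_N} ⊂ R` … satisfying conditions (i) and (ii) as described in Setting 4.1.1, and … (iii)
  `(h_l, p^{e_l}) ∈ 𝕀` for `l = 1, …, N`. … `ord_ℋ(f) = sup{n ; f ∈ 𝔪ⁿ + (ℋ)}` … `μ_ℋ(𝕀) := inf{ord_ℋ(f)/a ; (f, a) ∈ 𝕀,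
  a > 0}` … For `B = (b_1, …, b_N) ∈ ℤ^N_{≥0}`, we set `[B] = (b_1 p^{e_1}, …, b_N p^{e_N})` and hence
  `|[B]| = ∑ b_l p^{e_l}`.» — `R` as in the chapter setting p0085 L17 (localization at a closed point of a smooth
  variety over `k = k̄`, or its completion).
* **Lemma 4.1.4.1 (Coefficient Lemma)** (p0091 L4–L10): «Let `μ ∈ ℝ_{≥0}` be a nonnegative number such that
  `μ < μ_ℋ(𝕀)`. Set `𝕀'_t = 𝕀_t ∩ 𝔪^{⌈μt⌉}`, where we use the convention that `𝔪ⁿ = R` for `n ≤ 0`. Then for any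
  `a ∈ ℝ`, we have `𝕀_a = ∑_B 𝕀'_{a−|[B]|} H^B`.»
* Proof (p0091 L12 – p0093 L20): `𝔮_a := ∑_B 𝕀'_{a−|[B]|} H^B ⊂ 𝕀_a`; `a ≤ 0` trivial; **Step 1** the inclusions
  `(⋆)_{c,r}: 𝕀_a ∩ 𝔪^r ⊂ J_{c,r} := 𝔪^{r+1} + 𝔮_a + ∑_{|[B]| ≥ c} 𝔪^{r−|[B]|} H^B` (`1 ≤ c ≤ ⌈a⌉`) by induction on
  `c` — Case 1 by the definition of `μ_ℋ` and Supporting Lemma 3, Case 2 by applying `∂_{[B_o]}` (`|[B_o]| = c−1`)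
  w.r.t. a regular system of parameters with `h_l − x_l^{p^{e_l}} ∈ 𝔪^{p^{e_l}+1}`, the generalized product rule,
  `∂_J X^{[B]} = ([B] over J) X^{[B]−J}`, «`([B] over J)` is zero unless `J = [K]`», «`([B] over [K]) = (B over K)`»,
  (*) `∂_{[B_o]} f − α_{B_o} ∈ ∑_{|[B]|≥1} 𝔪^{r−c+1−|[B]|} H^B + 𝔪^{r−c+2}`, 𝔇-saturation `∂_{[B_o]} f ∈ 𝕀_{a−c+1} ∩
  𝔪^{r−c+1}` and (**) = `(⋆)_{1,r−c+1}`; **Step 2** «Finishing argument»: `𝕀_a ∩ 𝔪^r + 𝔮_a = 𝕀_a ∩ 𝔪^{r+1} + 𝔮_a`,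
  hence `𝕀_a = 𝕀_a ∩ 𝔪^{⌈μa⌉} + 𝔮_a = 𝔮_a`.

## What is typed and proved, and how (faithfulness notes)

* DEFINITIONS (real, with API): `bracketDeg p e B = |[B]|` and `hPow h B = H^B` for `B : ι →₀ ℕ` (the printed
  `ℤ^N_{≥0}`, `ι` a finite index type for `l = 1, …, N`); `levelCut 𝕀 μ t = 𝕀'_t = 𝕀_t ⊓ 𝔪^{⌈μ t⌉₊}` (natural-number
  ceiling, `= 0` for `μ t ≤ 0`: the printed convention «`𝔪ⁿ = R` for `n ≤ 0`»); `qIdeal p h e 𝕀 μ a = 𝔮_a =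
  ⨆_B 𝕀'_{a−|[B]|} · (H^B)`; the Step-1 ideals `tailIdeal` (`∑_{|[B]| ≥ c} 𝔪^{r−|[B]|} H^B`, truncated `r − |[B]|`,
  matching the same convention) and `jIdeal` (`J_{c,r}`); coordinates `bracket`, `brX` (`[B]` as a multi-index on the
  regular system of parameters through the injective relabelling `v : ι → Fin d` of `exists_rsop_sub_pow_mem`),
  `divb`, `xPow` (`X^M`).
* **`coefficientLemma`** — Lemma 4.1.4.1 for a REGULAR LOCAL ring `R`, essentially of finite type and formally smooth
  over a PERFECT field `k` (so that truncated Hasse–Schmidt systems along any regular system of parameters exist,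
  `Resolution.exists_hasseSystem_of_span_eq_maximalIdeal`, EGA IV₄ 16.11.2; the printed `R = A_𝔫`, `A` smooth over
  `k = k̄`, is an instance — the printed COMPLETION case is not covered by these hypotheses, flagged
  `TODO(general form)`), of exponential characteristic `p` (`[ExpChar R p]`; `p = 1` = characteristic zero), `𝕀`
  𝔇-saturated (`IdealisticFiltration.IsDSaturated k`, Def. 2.1.2.1 = Grothendieck differential operators over `k`),
  `(h, e)` with `IsWeakLGS p 𝕀 h e` (= Setting 4.1.1 (i)(ii) with (ii) at every level + Setting 4.1.3 (iii); the tree's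
  form of the hypotheses of Thm. 4.2.1.1), `μ ≥ 0` real with `ENNReal.ofReal μ < muTilde 𝕀 h` (`μ < μ_ℋ(𝕀) ≤ ∞`,
  `WeakOrderMuTilde.lean`): `𝕀.level a = qIdeal p h e 𝕀 μ a` for every real `a`. `IsLGS.coefficientLemma` for a
  leading generator system.
* PROOF = the printed proof, step for step: `level_eq_qIdeal_of_nonpos` (`a ≤ 0`); Step 1 Case 1
  `level_inf_pow_le_jIdeal_one` (from `IsWeakLGS.span_inf_maximalIdeal_pow_eq` = Supporting Lemma 3 and
  `mem_pow_ceil_sup_span_of_lt_muTilde` = «by definition of `μ_ℋ(𝕀)` and `μ`»); Step 1 Case 2 = `term_sub_mem`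
  (one term of the generalized product rule: `hPow_sub_xPow_mem` = `H^B ≡ X^{[B]}`, exact divided-power values, Lucas
  `cast_coef_eq_zero` / `cast_coef_eq_prod` from Mathlib's one-step Lucas theorem, `eq_of_le_of_bracketDeg_le` =
  «`K = B` forces `B = B_o`»), `apply_mul_hPow_sub_mem` (= (*)), and the induction `level_inf_pow_le_jIdeal`
  (modular step, finite representation `exists_finsupp_of_mem_tailIdeal`, 𝔇-saturation, (**), the shift
  `𝔮_{a−c+1} H^{B_o} ⊂ 𝔮_a` = `qIdeal_mul_span_hPow_le`, `tailIdeal_mul_span_hPow_le`); Step 2 =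
  `eq_of_inf_pow_le_sup_of_lt` + `level_eq_qIdeal_of_forall_le_jIdeal` (no Krull theorem needed, as in print).
  Differences from print: the Hasse–Schmidt system is truncated at level `n = ⌈a⌉₊` (only `∂_J` with `|J| ≤ ⌈a⌉ − 1`
  occur); natural-number truncated subtractions realise all printed exponents (which are `≥ 0` where used).

## References

* H. Kawanoue, Publ. RIMS 43 (2007) 819–909 = arXiv:math/0607009: Setting 4.1.3 (p0090 L33 – p0091 L2), Lemma 4.1.4.1
  (p0091 L4–L10) and its proof (p0091 L12 – p0093 L20), Rem. 4.1.4.2. [Kawanoue2007]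
* A. Grothendieck, J. Dieudonné, ÉGA IV₄, Thm. 16.11.2 (Hasse–Schmidt operators along coordinates; through the tree).
  [EGAIV4]
* E. Lucas' theorem on binomial coefficients modulo `p` (Mathlib `Choose.choose_modEq_choose_mod_mul_choose_div_nat`).
-/

noncomputable section

namespace Literature.AlgebraicGeometry.Kawanoue2007

open IsLocalRing MvPolynomial
open Literature.AlgebraicGeometry.Resolution
open Literature.RingTheory.HilbertSamuel (gradedPiece gradedPiece.mk)

universe u

/-! ## Two local-ring lemmas (file-private; copies of the private helpers of `SupportingLemmas.lean`) -/

section LocalLemmas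

variable {R : Type u} [CommRing R] [IsLocalRing R]

/-- Products: `𝔪^a · 𝔪^b ⊆ 𝔪^(a+b)`, element form. [folklore] -/
private theorem mul_mem_mpow_add {a b : ℕ} {f g : R} (hf : f ∈ maximalIdeal R ^ a)
    (hg : g ∈ maximalIdeal R ^ b) : f * g ∈ maximalIdeal R ^ (a + b) := by
  rw [pow_add]; exact Ideal.mul_mem_mul hf hg

/-- `a ≡ b mod 𝔪ⁿ⁺¹` with `b ∈ 𝔪ⁿ` implies `aᵐ ≡ bᵐ mod 𝔪^{nm+1}`. [folklore] -/
private theorem pow_sub_pow_mem_mpow_succ {a b : R} {n : ℕ} (hb : b ∈ maximalIdeal R ^ n)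
    (hab : a - b ∈ maximalIdeal R ^ (n + 1)) (m : ℕ) :
    a ^ m - b ^ m ∈ maximalIdeal R ^ (n * m + 1) := by
  have ha : a ∈ maximalIdeal R ^ n := by
    simpa using add_mem (Ideal.pow_le_pow_right (Nat.le_succ n) hab) hb
  induction m with
  | zero => simp
  | succ m ih =>
    have e : a ^ (m + 1) - b ^ (m + 1) = a * (a ^ m - b ^ m) + (a - b) * b ^ m := by ring
    rw [e]
    refine add_mem ?_ ?_
    · have := Ideal.mul_mem_mul ha ih
      rw [← pow_add] at this
      convert this using 2
      ring
    · have := Ideal.mul_mem_mul hab (Ideal.pow_mem_pow hb m)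
      rw [← pow_mul, ← pow_add] at this
      convert this using 2
      ring

end LocalLemmas

/-! ## Setting 4.1.3 / notation p0091 L1–L2: `[B]`, `|[B]|`, `H^B`, `𝕀'_t`, `𝔮_a` -/

section Notation

variable {R : Type u} [CommRing R]
variable (p : ℕ) {ι : Type*} [Fintype ι] (h : ι → R) (e : ι → ℕ)

/-- `|[B]| = ∑_l b_l p^{e_l}`, the weighted degree of the multi-index `B = (b_l)_l` («For `B = (b_1, …, b_N) ∈ ℤ^N_{≥0}`,
we set `[B] = (b_1 p^{e_1}, …, b_N p^{e_N})` and hence `|[B]| = ∑_{l=1}^N b_l p^{e_l}`», p0091 L1–L2).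
[cite: Kawanoue2007, §4.1.3 (notation before Lemma 4.1.4.1)] -/
def bracketDeg (B : ι →₀ ℕ) : ℕ := ∑ l, B l * p ^ e l

/-- `H^B = ∏_l h_l^{b_l}` for `ℋ = {h_l}` and a multi-index `B`. [cite: Kawanoue2007, Lemma 4.1.4.1 (statement)] -/
def hPow (B : ι →₀ ℕ) : R := ∏ l, h l ^ B l

omit [Fintype ι] in
/-- `|[0]| = 0`. [cite: Kawanoue2007, §4.1.3 (notation `[B]`, `|[B]|`, chunk p0091 L1–L3)] -/
@[simp] theorem bracketDeg_zero [Fintype ι] : bracketDeg p e (0 : ι →₀ ℕ) = 0 := by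
  simp [bracketDeg]

/-- `|[B + B']| = |[B]| + |[B']|`. [cite: Kawanoue2007, §4.1.3 (notation `[B]`, `|[B]|`, chunk p0091 L1–L3)] -/
theorem bracketDeg_add (B B' : ι →₀ ℕ) :
    bracketDeg p e (B + B') = bracketDeg p e B + bracketDeg p e B' := by
  simp only [bracketDeg, Finsupp.coe_add, Pi.add_apply, add_mul, Finset.sum_add_distrib]

/-- `|[δ_l · n]| = n p^{e_l}`. [cite: Kawanoue2007, §4.1.3 (notation `[B]`, `|[B]|`, chunk p0091 L1–L3)] -/
theorem bracketDeg_single [DecidableEq ι] (l : ι) (n : ℕ) :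
    bracketDeg p e (Finsupp.single l n) = n * p ^ e l := by
  classical
  rw [bracketDeg, Finset.sum_eq_single l]
  · rw [Finsupp.single_eq_same]
  · intro b _ hb; rw [Finsupp.single_eq_of_ne hb, zero_mul]
  · intro h; exact absurd (Finset.mem_univ l) h

/-- `|[B]| ≥ |B|` when `p ≥ 1`; in particular `|[B]| ≥ 1` for `B ≠ 0`.
[cite: Kawanoue2007, §4.1.3 (notation `[B]`, `|[B]|`, chunk p0091 L1–L3)] -/
theorem degree_le_bracketDeg (hp : 0 < p) (B : ι →₀ ℕ) : B.degree ≤ bracketDeg p e B := by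
  classical
  rw [bracketDeg, Finsupp.degree_eq_sum]
  exact Finset.sum_le_sum fun l _ => Nat.le_mul_of_pos_right _ (pow_pos hp _)

/-- `|[B]| ≥ 1` for `B ≠ 0` (`p ≥ 1`). [cite: Kawanoue2007, §4.1.3 (notation `[B]`, `|[B]|`, chunk p0091 L1–L3)] -/
theorem bracketDeg_pos (hp : 0 < p) {B : ι →₀ ℕ} (hB : B ≠ 0) : 0 < bracketDeg p e B := by
  have h1 : 0 < B.degree := by
    rw [pos_iff_ne_zero, Ne, Finsupp.degree_eq_zero_iff]
    exact hB
  exact h1.trans_le (degree_le_bracketDeg p e hp B)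

/-- `H^0 = 1`. [cite: Kawanoue2007, Lemma 4.1.4.1 (statement: `H^B`)] -/
@[simp] theorem hPow_zero : hPow h (0 : ι →₀ ℕ) = 1 := by
  simp [hPow]

/-- `H^{B+B'} = H^B H^{B'}`. [cite: Kawanoue2007, Lemma 4.1.4.1 (statement: `H^B`)] -/
theorem hPow_add (B B' : ι →₀ ℕ) : hPow h (B + B') = hPow h B * hPow h B' := by
  simp only [hPow, Finsupp.coe_add, Pi.add_apply, pow_add, Finset.prod_mul_distrib]

/-- `H^{δ_l · n} = h_l^n`. [cite: Kawanoue2007, Lemma 4.1.4.1 (statement: `H^B`)] -/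
theorem hPow_single [DecidableEq ι] (l : ι) (n : ℕ) : hPow h (Finsupp.single l n) = h l ^ n := by
  classical
  rw [hPow, Finset.prod_eq_single l]
  · rw [Finsupp.single_eq_same]
  · intro b _ hb; rw [Finsupp.single_eq_of_ne hb, pow_zero]
  · intro h'; exact absurd (Finset.mem_univ l) h'

/-- `H^B ∈ 𝕀_{|[B]|}` when `(h_l, p^{e_l}) ∈ 𝕀` for all `l` (condition (iii) of Setting 4.1.3).
[cite: Kawanoue2007, §4.1.3 (iii)] -/
theorem hPow_mem_level (𝕀 : IdealisticFiltration R) (hlev : ∀ l, h l ∈ 𝕀.level ((p ^ e l : ℕ) : ℝ))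
    (B : ι →₀ ℕ) : hPow h B ∈ 𝕀.level (bracketDeg p e B : ℝ) := by
  classical
  simp only [hPow, bracketDeg]
  -- induction over the finite product
  have key : ∀ s : Finset ι, (∏ l ∈ s, h l ^ B l) ∈ 𝕀.level ((∑ l ∈ s, B l * p ^ e l : ℕ) : ℝ) := by
    intro s
    induction s using Finset.induction_on with
    | empty => simp [IdealisticFiltration.mem_level_zero]
    | @insert a s ha ih =>
      rw [Finset.prod_insert ha, Finset.sum_insert ha, Nat.cast_add, add_comm ((B a * p ^ e a : ℕ) : ℝ)]
      refine 𝕀.mul_mem ?_ ih |> fun hmem => by simpa [add_comm, mul_comm] using hmem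
      have := 𝕀.pow_mem (hlev a) (B a)
      simpa [Nat.cast_mul, Nat.cast_pow, mul_comm] using this
  simpa using key Finset.univ

/-- `H^B ∈ 𝔪^{|[B]|}` when `h_l ∈ 𝔪^{p^{e_l}}` for all `l` (condition (i)). [cite: Kawanoue2007, Setting 4.1.1 (i)] -/
theorem hPow_mem_pow [IsLocalRing R] (pow_mem : ∀ l, h l ∈ maximalIdeal R ^ p ^ e l) (B : ι →₀ ℕ) :
    hPow h B ∈ maximalIdeal R ^ bracketDeg p e B := by
  classical
  simp only [hPow, bracketDeg]
  rw [← Finset.prod_pow_eq_pow_sum]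
  exact Ideal.prod_mem_prod fun l _ => by
    rw [mul_comm, pow_mul]
    exact Ideal.pow_mem_pow (pow_mem l) _

variable [IsLocalRing R]

/-- `𝕀'_t = 𝕀_t ∩ 𝔪^{⌈μ t⌉}` («where we use the convention that `𝔪ⁿ = R` for `n ≤ 0`»: the natural-number
ceiling `⌈μ t⌉₊` is `0` for `μ t ≤ 0`). [cite: Kawanoue2007, Lemma 4.1.4.1 (statement)] -/
def levelCut (𝕀 : IdealisticFiltration R) (μ t : ℝ) : Ideal R :=
  𝕀.level t ⊓ maximalIdeal R ^ ⌈μ * t⌉₊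

/-- `𝕀'_t ⊆ 𝕀_t`. [cite: Kawanoue2007, Lemma 4.1.4.1 (statement: `𝕀'_t = 𝕀_t ∩ 𝔪^{⌈μt⌉}`)] -/
theorem levelCut_le_level (𝕀 : IdealisticFiltration R) (μ t : ℝ) : levelCut 𝕀 μ t ≤ 𝕀.level t :=
  inf_le_left

/-- `𝕀'_t ⊆ 𝔪^{⌈μt⌉}`. [cite: Kawanoue2007, Lemma 4.1.4.1 (statement: `𝕀'_t = 𝕀_t ∩ 𝔪^{⌈μt⌉}`)] -/
theorem levelCut_le_pow (𝕀 : IdealisticFiltration R) (μ t : ℝ) :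
    levelCut 𝕀 μ t ≤ maximalIdeal R ^ ⌈μ * t⌉₊ :=
  inf_le_right

/-- `𝕀'_t = R` for `t ≤ 0` and `μ ≥ 0`. [cite: Kawanoue2007, Lemma 4.1.4.1 (proof: «When `a ≤ 0`, since `R = 𝕀'_a`»)] -/
theorem levelCut_of_nonpos (𝕀 : IdealisticFiltration R) {μ t : ℝ} (hμ : 0 ≤ μ) (ht : t ≤ 0) :
    levelCut 𝕀 μ t = ⊤ := by
  rw [levelCut, 𝕀.level_eq_top_of_nonpos ht, top_inf_eq, Nat.ceil_eq_zero.mpr, pow_zero, Ideal.one_eq_top]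
  exact mul_nonpos_of_nonneg_of_nonpos hμ ht

/-- **`𝔮_a = ∑_B 𝕀'_{a − |[B]|} H^B`** (the right-hand side of the Coefficient Lemma), as a supremum of ideals
over all multi-indices `B ∈ ℕ^ι`. [cite: Kawanoue2007, Lemma 4.1.4.1 (statement and proof, `𝔮_a`)] -/
def qIdeal (𝕀 : IdealisticFiltration R) (μ a : ℝ) : Ideal R :=
  ⨆ B : ι →₀ ℕ, levelCut 𝕀 μ (a - bracketDeg p e B) * Ideal.span {hPow h B}

/-- Each summand lies in `𝔮_a`.
[cite: Kawanoue2007, Lemma 4.1.4.1 (proof: `𝔮_a = ∑_B 𝕀'_{a−|[B]|} H^B`, chunk p0091 L17)] -/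
theorem levelCut_mul_le_qIdeal (𝕀 : IdealisticFiltration R) (μ a : ℝ) (B : ι →₀ ℕ) :
    levelCut 𝕀 μ (a - bracketDeg p e B) * Ideal.span {hPow h B} ≤ qIdeal p h e 𝕀 μ a :=
  le_iSup (fun B : ι →₀ ℕ => levelCut 𝕀 μ (a - bracketDeg p e B) * Ideal.span {hPow h B}) B

/-- The `B = 0` summand: `𝕀'_a ⊆ 𝔮_a`. [cite: Kawanoue2007, Lemma 4.1.4.1 (proof, Step 2: «`𝕀'_a + 𝔮_a = 𝔮_a`»)] -/
theorem levelCut_le_qIdeal (𝕀 : IdealisticFiltration R) (μ a : ℝ) : levelCut 𝕀 μ a ≤ qIdeal p h e 𝕀 μ a := by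
  have := levelCut_mul_le_qIdeal p h e 𝕀 μ a 0
  simp only [bracketDeg_zero, Nat.cast_zero, sub_zero, hPow_zero, Ideal.span_singleton_one, Ideal.mul_top] at this
  exact this

/-- Element form: `γ ∈ 𝕀'_{a−|[B]|}` ⇒ `γ H^B c ∈ 𝔮_a`.
[cite: Kawanoue2007, Lemma 4.1.4.1 (proof: `𝔮_a = ∑_B 𝕀'_{a−|[B]|} H^B`, chunk p0091 L17)] -/
theorem mul_hPow_mem_qIdeal (𝕀 : IdealisticFiltration R) (μ a : ℝ) (B : ι →₀ ℕ) {γ : R}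
    (hγ : γ ∈ levelCut 𝕀 μ (a - bracketDeg p e B)) (c : R) : γ * (hPow h B * c) ∈ qIdeal p h e 𝕀 μ a :=
  levelCut_mul_le_qIdeal p h e 𝕀 μ a B (Ideal.mul_mem_mul hγ (Ideal.mem_span_singleton'.mpr ⟨c, mul_comm _ _⟩))

/-- **`𝔮_a ⊆ 𝕀_a`** (condition (iii): `𝕀'_{a−|[B]|} H^B ⊆ 𝕀_{a−|[B]|} 𝕀_{|[B]|} ⊆ 𝕀_a`).
[cite: Kawanoue2007, Lemma 4.1.4.1 (proof: «`𝔮_a ⊂ 𝕀_a`»)] -/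
theorem qIdeal_le_level (𝕀 : IdealisticFiltration R) (hlev : ∀ l, h l ∈ 𝕀.level ((p ^ e l : ℕ) : ℝ))
    (μ a : ℝ) : qIdeal p h e 𝕀 μ a ≤ 𝕀.level a := by
  refine iSup_le fun B => ?_
  rw [Ideal.mul_le]
  intro γ hγ c hc
  obtain ⟨c, rfl⟩ := Ideal.mem_span_singleton'.mp hc
  have h1 := 𝕀.mul_mem (levelCut_le_level 𝕀 μ _ hγ) (hPow_mem_level p h e 𝕀 hlev B)
  rw [sub_add_cancel] at h1
  simpa [mul_comm, mul_left_comm] using 𝕀.mul_mem_left c h1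

/-- **Shift**: `𝔮_{a'} · H^{B₀} ⊆ 𝔮_{a' + |[B₀]|}` (re-index `B ↦ B + B₀`).
[cite: Kawanoue2007, Lemma 4.1.4.1 (proof, Step 1 Case 2: «`𝔮_{a−c+1} H^{B_o} ⊂ 𝔮_a`»)] -/
theorem qIdeal_mul_span_hPow_le (𝕀 : IdealisticFiltration R) (μ a' : ℝ) (B₀ : ι →₀ ℕ) :
    qIdeal p h e 𝕀 μ a' * Ideal.span {hPow h B₀} ≤ qIdeal p h e 𝕀 μ (a' + bracketDeg p e B₀) := by
  rw [qIdeal, Ideal.iSup_mul]  -- (⨆ B, X_B) * Y = ⨆ B, X_B * Y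
  refine iSup_le fun B => ?_
  rw [mul_assoc, Ideal.span_singleton_mul_span_singleton, ← hPow_add]
  have : a' - bracketDeg p e B = a' + bracketDeg p e B₀ - bracketDeg p e (B + B₀) := by
    rw [bracketDeg_add, Nat.cast_add]; ring
  rw [this]
  exact levelCut_mul_le_qIdeal p h e 𝕀 μ _ (B + B₀)

end Notation

/-! ## The ideals `J_{c,r}` of Step 1, Case 1 of Step 1, and the finishing Step 2 -/

section StepOne

variable {R : Type u} [CommRing R] [IsLocalRing R]
variable (p : ℕ) {ι : Type*} [Fintype ι] (h : ι → R) (e : ι → ℕ) (𝕀 : IdealisticFiltration R)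

/-- `∑_{|[B]| ≥ c} 𝔪^{r−|[B]|} H^B`, the third summand of `J_{c,r}` (as a supremum of ideals).
[cite: Kawanoue2007, Lemma 4.1.4.1 (proof, Step 1: `J_{c,r}`)] -/
def tailIdeal (c r : ℕ) : Ideal R :=
  ⨆ B : ι →₀ ℕ, ⨆ (_ : c ≤ bracketDeg p e B), maximalIdeal R ^ (r - bracketDeg p e B) * Ideal.span {hPow h B}

/-- **`J_{c,r} = 𝔪^{r+1} + 𝔮_a + ∑_{|[B]| ≥ c} 𝔪^{r−|[B]|} H^B`** (p0091 L22–L23).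
[cite: Kawanoue2007, Lemma 4.1.4.1 (proof, Step 1)] -/
def jIdeal (μ a : ℝ) (c r : ℕ) : Ideal R :=
  maximalIdeal R ^ (r + 1) ⊔ qIdeal p h e 𝕀 μ a ⊔ tailIdeal p h e c r

/-- Summands of the tail. [cite: Kawanoue2007, Lemma 4.1.4.1 (proof, Step 1: `J_{c,r}`, chunk p0091 L27)] -/
theorem pow_mul_span_le_tailIdeal {c : ℕ} (r : ℕ) {B : ι →₀ ℕ} (hB : c ≤ bracketDeg p e B) :
    maximalIdeal R ^ (r - bracketDeg p e B) * Ideal.span {hPow h B} ≤ tailIdeal p h e c r :=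
  le_iSup_of_le B (le_iSup_of_le hB le_rfl)

/-- The tail is antitone in `c`. [cite: Kawanoue2007, Lemma 4.1.4.1 (proof, Step 1: `J_{c,r}`, chunk p0091 L27)] -/
theorem tailIdeal_anti {c c' : ℕ} (hcc' : c ≤ c') (r : ℕ) : tailIdeal p h e c' r ≤ tailIdeal p h e c r :=
  iSup₂_le fun _ hB => pow_mul_span_le_tailIdeal p h e r (hcc'.trans hB)

/-- For `c ≥ a` the tail is swallowed by `𝔮_a`: `|[B]| ≥ c ≥ a ⇒ 𝕀'_{a−|[B]|} = R`
(«since `𝕀'_{a−|[B]|} = R` for `B` with `|[B]| ≥ ⌈a⌉`», p0093 L18). [cite: Kawanoue2007, Lemma 4.1.4.1 (proof, Step 2)] -/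
theorem tailIdeal_le_qIdeal {μ a : ℝ} (hμ : 0 ≤ μ) {c : ℕ} (hc : a ≤ c) (r : ℕ) :
    tailIdeal p h e c r ≤ qIdeal p h e 𝕀 μ a := by
  refine iSup₂_le fun B hB => ?_
  refine le_trans (Ideal.mul_mono_left le_top) ?_
  have hle : a - (bracketDeg p e B : ℝ) ≤ 0 := by
    have : (c : ℝ) ≤ bracketDeg p e B := by exact_mod_cast hB
    linarith
  rw [← levelCut_of_nonpos 𝕀 hμ hle]
  exact levelCut_mul_le_qIdeal p h e 𝕀 μ a B

/-- **Step 2 («Finishing argument»), abstract form**: if `𝔮 ⊆ I`, `I ∩ 𝔪^N ⊆ 𝔮` and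
`I ∩ 𝔪^r ⊆ 𝔪^{r+1} + 𝔮` for all `r < N`, then `I = 𝔮` (descending induction; no Krull intersection
theorem is needed). [cite: Kawanoue2007, Lemma 4.1.4.1 (proof, Step 2)] -/
theorem eq_of_inf_pow_le_sup_of_lt {S : Type*} [CommRing S] (M I 𝔮 : Ideal S) (h𝔮 : 𝔮 ≤ I) (N : ℕ)
    (hN : I ⊓ M ^ N ≤ 𝔮) (hstep : ∀ r, r < N → I ⊓ M ^ r ≤ M ^ (r + 1) ⊔ 𝔮) : I = 𝔮 := by
  refine le_antisymm ?_ h𝔮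
  have key : ∀ r, r ≤ N → I ≤ (I ⊓ M ^ r) ⊔ 𝔮 := by
    intro r
    induction r with
    | zero => intro _; simp
    | succ r ih =>
      intro hr
      refine (ih (Nat.le_of_succ_le hr)).trans (sup_le ?_ le_sup_right)
      rintro f ⟨hfI, hfr⟩
      obtain ⟨m, hm, q, hq, rfl⟩ := Submodule.mem_sup.mp (hstep r (by omega) ⟨hfI, hfr⟩)
      refine Submodule.mem_sup.mpr ⟨m, ⟨?_, hm⟩, q, hq, rfl⟩
      simpa using I.sub_mem hfI (h𝔮 hq)
  exact (key N le_rfl).trans (sup_le hN le_rfl)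

/-- For `a ≤ 0` the Coefficient Lemma is trivial: `𝕀_a = R = 𝔮_a`.
[cite: Kawanoue2007, Lemma 4.1.4.1 (proof: «When `a ≤ 0` …»)] -/
theorem level_eq_qIdeal_of_nonpos {μ a : ℝ} (hμ : 0 ≤ μ) (ha : a ≤ 0) :
    𝕀.level a = qIdeal p h e 𝕀 μ a := by
  refine le_antisymm ?_ ?_
  · rw [𝕀.level_eq_top_of_nonpos ha, ← levelCut_of_nonpos 𝕀 hμ ha]
    exact levelCut_le_qIdeal p h e 𝕀 μ a
  · rw [𝕀.level_eq_top_of_nonpos ha]; exact le_top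

/-- **Step 2 applied**: the inclusions `(⋆)_{⌈a⌉, r}` (`r ∈ ℤ_{≥0}`) imply the Coefficient Lemma at level
`a > 0` (`𝔮_a ⊆ 𝕀_a` by condition (iii) `hlev`). [cite: Kawanoue2007, Lemma 4.1.4.1 (proof, Step 2)] -/
theorem level_eq_qIdeal_of_forall_le_jIdeal (hlev : ∀ l, h l ∈ 𝕀.level ((p ^ e l : ℕ) : ℝ))
    {μ a : ℝ} (hμ : 0 ≤ μ)
    (hstar : ∀ r : ℕ, 𝕀.level a ⊓ maximalIdeal R ^ r ≤ jIdeal p h e 𝕀 μ a ⌈a⌉₊ r) :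
    𝕀.level a = qIdeal p h e 𝕀 μ a := by
  refine eq_of_inf_pow_le_sup_of_lt (maximalIdeal R) _ _ (qIdeal_le_level p h e 𝕀 hlev μ a) ⌈μ * a⌉₊
    (levelCut_le_qIdeal p h e 𝕀 μ a) fun r _ => (hstar r).trans ?_
  refine sup_le (sup_le le_sup_left le_sup_right) ?_
  exact (tailIdeal_le_qIdeal p h e 𝕀 hμ (Nat.le_ceil a) r).trans le_sup_right

end StepOne

section CaseOne

variable {R : Type u} [CommRing R] [IsLocalRing R]

/-- **`μ < μ_ℋ(𝕀)` read off an element**: for `(f, a) ∈ 𝕀`, `a > 0`, one has `ord_ℋ(f) ≥ ⌈μ a⌉`, i.e.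
`f ∈ 𝔪^{⌈μa⌉} + (ℋ)` («by definition of `μ_ℋ(𝕀)` and `μ`», p0091 L31). [cite: Kawanoue2007, Lemma 4.1.4.1 (proof, Step 1 Case 1)] -/
theorem mem_pow_ceil_sup_span_of_lt_muTilde (𝕀 : IdealisticFiltration R) {ι : Type*} (h : ι → R)
    {μ : ℝ} (hμ0 : 0 ≤ μ) (hμ : ENNReal.ofReal μ < muTilde 𝕀 h) {f : R} {a : ℝ}
    (hf : f ∈ 𝕀.level a) (ha : 0 < a) :
    f ∈ maximalIdeal R ^ ⌈μ * a⌉₊ ⊔ Ideal.span (Set.range h) := by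
  rw [← le_ordMod_iff]
  have h1 : ENNReal.ofReal μ < muModElem (Ideal.span (Set.range h)) f a :=
    hμ.trans_le (muTilde_le 𝕀 h hf ha)
  unfold muModElem at h1
  rw [ENNReal.lt_div_iff_mul_lt (Or.inl (ENNReal.ofReal_pos.mpr ha).ne')
    (Or.inl ENNReal.ofReal_ne_top), ← ENNReal.ofReal_mul hμ0] at h1
  rcases eq_or_ne (ordMod (Ideal.span (Set.range h)) f) ⊤ with htop | hne
  · rw [htop]; exact le_top
  obtain ⟨n, hn⟩ := ENat.ne_top_iff_exists.mp hne
  rw [← hn] at h1 ⊢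
  have h2 : μ * a < n := by
    rw [ENat.toENNReal_coe] at h1
    have h3 := (ENNReal.ofReal_lt_iff_lt_toReal (mul_nonneg hμ0 ha.le)
      (ENNReal.natCast_ne_top n)).mp h1
    simpa using h3
  exact_mod_cast Nat.ceil_le.mpr h2.le

end CaseOne

section CaseOne'

variable {R : Type u} [CommRing R] [IsRegularLocalRing R] (p : ℕ) [ExpChar R p]
variable {ι : Type*} [Fintype ι] (h : ι → R) (e : ι → ℕ) (𝕀 : IdealisticFiltration R)

/-- **Step 1, Case 1 (`c = 1`)**: for `a > 0` and every `r`,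
`𝕀_a ∩ 𝔪^r ⊆ J_{1,r} = 𝔪^{r+1} + 𝔮_a + ∑_{|[B]| ≥ 1} 𝔪^{r−|[B]|} H^B`; if `⌈μa⌉ ≤ r` through
`𝕀'_a ⊆ 𝔮_a`, else through `𝔪^{⌈μa⌉} ⊆ 𝔪^{r+1}` and **Supporting Lemma 3**
(`(∑ R h_l) ∩ 𝔪^r = ∑ 𝔪^{r−p^{e_l}} h_l`, the `|B| = 1` summands).
[cite: Kawanoue2007, Lemma 4.1.4.1 (proof, Step 1 Case 1, p0091 L26–L40)] -/
theorem level_inf_pow_le_jIdeal_one (H : IsWeakLGS p 𝕀 h e) {μ : ℝ} (hμ0 : 0 ≤ μ)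
    (hμ : ENNReal.ofReal μ < muTilde 𝕀 h) {a : ℝ} (ha : 0 < a) (r : ℕ) :
    𝕀.level a ⊓ maximalIdeal R ^ r ≤ jIdeal p h e 𝕀 μ a 1 r := by
  classical
  rintro f ⟨hfa, hfr⟩
  have hord := mem_pow_ceil_sup_span_of_lt_muTilde 𝕀 h hμ0 hμ hfa ha
  by_cases hN : ⌈μ * a⌉₊ ≤ r
  · -- `f ∈ 𝕀_a ∩ 𝔪^{⌈μa⌉} = 𝕀'_a ⊆ 𝔮_a`
    have hf' : f ∈ levelCut 𝕀 μ a := ⟨hfa, Ideal.pow_le_pow_right hN hfr⟩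
    exact Ideal.mem_sup_left (Ideal.mem_sup_right (levelCut_le_qIdeal p h e 𝕀 μ a hf'))
  · rw [not_le] at hN
    obtain ⟨m, hm, g, hg, rfl⟩ := Submodule.mem_sup.mp hord
    have hm' : m ∈ maximalIdeal R ^ (r + 1) := Ideal.pow_le_pow_right (by omega) hm
    have hgr : g ∈ maximalIdeal R ^ r := by
      have : m + g - m ∈ maximalIdeal R ^ r :=
        sub_mem hfr (Ideal.pow_le_pow_right (by omega) hm)
      simpa using this
    -- Supporting Lemma 3
    have hSL3 : g ∈ ⨆ l, maximalIdeal R ^ (r - p ^ e l) * Ideal.span {h l} := by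
      rw [← H.span_inf_maximalIdeal_pow_eq p h e r]
      exact ⟨hg, hgr⟩
    refine Ideal.add_mem _ (Ideal.mem_sup_left (Ideal.mem_sup_left hm')) (Ideal.mem_sup_right ?_)
    have hp : 0 < p := expChar_pos R p
    refine (show (⨆ l, maximalIdeal R ^ (r - p ^ e l) * Ideal.span {h l}) ≤ tailIdeal p h e 1 r from
      iSup_le fun l => ?_) hSL3
    have hB : 1 ≤ bracketDeg p e (Finsupp.single l 1) := by
      rw [bracketDeg_single, one_mul]; exact Nat.one_le_pow _ _ hp
    refine le_trans ?_ (pow_mul_span_le_tailIdeal p h e r hB)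
    rw [bracketDeg_single, one_mul, hPow_single, pow_one]

end CaseOne'

/-! ## The binomial coefficients `([B] over J)` modulo `p` (Lucas), p0092 L14–L18 -/

section Binomials

/-- Lucas: `(b p^e over j) ≡ 0 (mod p)` unless `p^e ∣ j` («the binomial coefficient `([B] over J)` is zero
unless `J = [K]`», p0092 L14). [folklore] -/
private theorem choose_mul_pow_modEq_zero {p : ℕ} [hp : Fact p.Prime] :
    ∀ (e b j : ℕ), ¬ p ^ e ∣ j → (b * p ^ e).choose j ≡ 0 [MOD p]
  | 0, b, j, hj => absurd (by simp) hj
  | e + 1, b, j, hj => by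
    have h1 := Choose.choose_modEq_choose_mod_mul_choose_div_nat (n := b * p ^ (e + 1)) (k := j) (p := p)
    have hn : b * p ^ (e + 1) % p = 0 := by
      rw [pow_succ, ← mul_assoc]; exact Nat.mul_mod_left _ _
    have hn' : b * p ^ (e + 1) / p = b * p ^ e := by
      rw [pow_succ, ← mul_assoc, Nat.mul_div_cancel _ hp.out.pos]
    rw [hn, hn'] at h1
    by_cases hjp : j % p = 0
    · -- `j = p (j / p)` and `p^e ∤ j / p`
      have hj' : ¬ p ^ e ∣ j / p := by
        intro hdvd
        apply hj
        rw [← Nat.div_add_mod j p, hjp, add_zero, pow_succ, mul_comm (p ^ e) p]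
        exact Nat.mul_dvd_mul_left p hdvd
      have h2 := choose_mul_pow_modEq_zero e b (j / p) hj'
      rw [hjp, Nat.choose_zero_right, one_mul] at h1
      exact h1.trans h2
    · rw [Nat.choose_eq_zero_of_lt (Nat.pos_of_ne_zero hjp), zero_mul] at h1
      exact h1

/-- Lucas: `(b p^e over c p^e) ≡ (b over c) (mod p)` («`([B] over [K]) = (B over K)`», p0092 L16–L18). [folklore] -/
private theorem choose_mul_pow_mul_pow_modEq {p : ℕ} [hp : Fact p.Prime] :
    ∀ (e b c : ℕ), (b * p ^ e).choose (c * p ^ e) ≡ b.choose c [MOD p]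
  | 0, b, c => by simp [Nat.ModEq.refl]
  | e + 1, b, c => by
    have h1 := Choose.choose_modEq_choose_mod_mul_choose_div_nat
      (n := b * p ^ (e + 1)) (k := c * p ^ (e + 1)) (p := p)
    have hn : ∀ x : ℕ, x * p ^ (e + 1) % p = 0 := fun x => by
      rw [pow_succ, ← mul_assoc]; exact Nat.mul_mod_left _ _
    have hn' : ∀ x : ℕ, x * p ^ (e + 1) / p = x * p ^ e := fun x => by
      rw [pow_succ, ← mul_assoc, Nat.mul_div_cancel _ hp.out.pos]
    rw [hn, hn, hn', hn', Nat.choose_zero_right, one_mul] at h1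
    exact h1.trans (choose_mul_pow_mul_pow_modEq e b c)

variable {R : Type u} [CommRing R] (p : ℕ) [ExpChar R p]

/-- In a ring of exponential characteristic `p`: `(b p^e over j) = 0` unless `p^e ∣ j`.
[cite: Kawanoue2007, Lemma 4.1.4.1 (proof, Step 1 Case 2: «the binomial coefficient `([B] over J)` is zero unless `J = [K]`», chunk p0092 L21)] -/
theorem cast_choose_mul_pow_eq_zero (e b j : ℕ) (hj : ¬ p ^ e ∣ j) :
    (((b * p ^ e).choose j : ℕ) : R) = 0 := by
  cases ‹ExpChar R p› with
  | zero => exact absurd (by simp) hj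
  | prime hprime =>
    haveI := Fact.mk hprime
    rw [CharP.cast_eq_zero_iff R p]
    exact Nat.modEq_zero_iff_dvd.mp (choose_mul_pow_modEq_zero e b j hj)

/-- In a ring of exponential characteristic `p`: `(b p^e over c p^e) = (b over c)` (the `CharP` form is
`Literature.Algebra.Polynomial.CasasAlvero.cast_choose_mul_pow`; kept private here in the `ExpChar` form
to avoid the import). [folklore] -/
private theorem cast_choose_mul_pow_mul_pow (e b c : ℕ) :
    (((b * p ^ e).choose (c * p ^ e) : ℕ) : R) = (b.choose c : ℕ) := by
  cases ‹ExpChar R p› with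
  | zero => simp
  | prime hprime =>
    haveI := Fact.mk hprime
    exact (CharP.natCast_eq_natCast R p).mpr (choose_mul_pow_mul_pow_modEq e b c)

end Binomials

/-! ## Step 1 Case 2, coordinates: `[B]` as a multi-index, `X^{[B]}`, and `H^B ≡ X^{[B]} mod 𝔪^{|[B]|+1}` -/

section Coordinates

variable {R : Type u} [CommRing R]
variable (p : ℕ) {ι : Type*} [Fintype ι] (e : ι → ℕ)

/-- `[B] = (b_l p^{e_l})_l` as a multi-index on `ι`. [cite: Kawanoue2007, §4.1.3 (notation before Lemma 4.1.4.1)] -/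
def bracket (B : ι →₀ ℕ) : ι →₀ ℕ :=
  Finsupp.equivFunOnFinite.symm fun l => B l * p ^ e l

/-- `[B]_l = b_l p^{e_l}`. [cite: Kawanoue2007, §4.1.3 (notation `[B]`, `|[B]|`, chunk p0091 L1–L3)] -/
@[simp] theorem bracket_apply (B : ι →₀ ℕ) (l : ι) : bracket p e B l = B l * p ^ e l := by
  simp [bracket]

/-- `|[B]|` is the degree of `[B]`. [cite: Kawanoue2007, §4.1.3 (notation `[B]`, `|[B]|`, chunk p0091 L1–L3)] -/
theorem degree_bracket (B : ι →₀ ℕ) : (bracket p e B).degree = bracketDeg p e B := by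
  rw [Finsupp.degree_eq_sum, bracketDeg]
  exact Finset.sum_congr rfl fun l _ => bracket_apply p e B l

/-- `[B + B'] = [B] + [B']`. [cite: Kawanoue2007, §4.1.3 (notation `[B]`, `|[B]|`, chunk p0091 L1–L3)] -/
theorem bracket_add (B B' : ι →₀ ℕ) : bracket p e (B + B') = bracket p e B + bracket p e B' := by
  ext l; simp [add_mul]

/-- `[B − K] = [B] − [K]` (truncated subtraction). [cite: Kawanoue2007, §4.1.3 (notation `[B]`, `|[B]|`, chunk p0091 L1–L3)] -/
theorem bracket_tsub {K B : ι →₀ ℕ} : bracket p e (B - K) = bracket p e B - bracket p e K := by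
  ext l; simp [Nat.sub_mul]

/-- `K ≤ B ⇒ [K] ≤ [B]`. [cite: Kawanoue2007, §4.1.3 (notation `[B]`, `|[B]|`, chunk p0091 L1–L3)] -/
theorem bracket_mono {K B : ι →₀ ℕ} (hKB : K ≤ B) : bracket p e K ≤ bracket p e B := by
  intro l; simp only [bracket_apply]; exact Nat.mul_le_mul_right _ (hKB l)

/-- `B ↦ [B]` is injective (`p ≥ 1`). [cite: Kawanoue2007, §4.1.3 (notation `[B]`, `|[B]|`, chunk p0091 L1–L3)] -/
theorem bracket_injective (hp : 0 < p) : Function.Injective (bracket p e : (ι →₀ ℕ) → ι →₀ ℕ) := by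
  intro B B' hBB'
  ext l
  have := congrArg (fun f => f l) hBB'
  simp only [bracket_apply] at this
  exact Nat.eq_of_mul_eq_mul_right (pow_pos hp _) this

/-- `[K] ≤ [B] ⇒ K ≤ B` (`p ≥ 1`). [cite: Kawanoue2007, §4.1.3 (notation `[B]`, `|[B]|`, chunk p0091 L1–L3)] -/
theorem le_of_bracket_le (hp : 0 < p) {K B : ι →₀ ℕ} (h : bracket p e K ≤ bracket p e B) : K ≤ B := by
  intro l
  have := h l
  simp only [bracket_apply] at this
  exact Nat.le_of_mul_le_mul_right this (pow_pos hp _)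

/-- `|[K]| < |[B]|` for `K < B` (`p ≥ 1`).
[cite: Kawanoue2007, §4.1.3 (notation `[B]`, `|[B]|`, chunk p0091 L1–L3)] -/
theorem bracketDeg_lt_of_lt (hp : 0 < p) {K B : ι →₀ ℕ} (hKB : K < B) : bracketDeg p e K < bracketDeg p e B := by
  obtain ⟨hle, hne⟩ := lt_iff_le_and_ne.mp hKB
  obtain ⟨C, rfl⟩ := exists_add_of_le hle
  have hC : C ≠ 0 := by rintro rfl; exact hne (by simp)
  rw [bracketDeg_add]
  exact Nat.lt_add_of_pos_right (bracketDeg_pos p e hp hC)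

/-- `B ≤ B₀` and `|[B₀]| ≤ |[B]|` force `B = B₀` («If `K = B`, we have `B = B_o`, since `B = K ≤ B_o` and
`|[B_o]| = c − 1 ≤ |[B]|`», p0092 L24). [cite: Kawanoue2007, Lemma 4.1.4.1 (proof, Step 1 Case 2)] -/
theorem eq_of_le_of_bracketDeg_le (hp : 0 < p) {B B₀ : ι →₀ ℕ} (hle : B ≤ B₀)
    (hdeg : bracketDeg p e B₀ ≤ bracketDeg p e B) : B = B₀ := by
  by_contra hne
  exact absurd (bracketDeg_lt_of_lt p e hp (lt_of_le_of_ne hle hne)) (not_lt.mpr hdeg)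

variable {d : ℕ} (v : ι → Fin d)

/-- `[B]` transported to the regular system of parameters `x : Fin d → R` through the injective relabelling
`v : ι → Fin d` (`h_l ↔ x_{v l}`). [cite: Kawanoue2007, Lemma 4.1.4.1 (proof, Step 1 Case 2: «`∂_{[B_o]}`»)] -/
def brX (B : ι →₀ ℕ) : Fin d →₀ ℕ := Finsupp.mapDomain v (bracket p e B)

/-- `[B]_{v l} = b_l p^{e_l}` in the coordinates `x`. [cite: Kawanoue2007, Lemma 4.1.4.1 (proof, Step 1 Case 2: `∂_{[B_o]}`, `∂_J = ∂_{X^J}`, chunk p0092 L17)] -/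
theorem brX_apply (hv : Function.Injective v) (B : ι →₀ ℕ) (l : ι) : brX p e v B (v l) = B l * p ^ e l := by
  rw [brX, Finsupp.mapDomain_apply hv, bracket_apply]

/-- `[B]_i = 0` at the coordinates `x_i` not of the form `x_{v l}`. [cite: Kawanoue2007, Lemma 4.1.4.1 (proof, Step 1 Case 2: `∂_{[B_o]}`, `∂_J = ∂_{X^J}`, chunk p0092 L17)] -/
theorem brX_apply_of_not_mem {B : ι →₀ ℕ} {i : Fin d} (hi : i ∉ Set.range v) : brX p e v B i = 0 :=
  Finsupp.mapDomain_notin_range _ _ hi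

/-- `[0] = 0` in the coordinates `x`. [cite: Kawanoue2007, Lemma 4.1.4.1 (proof, Step 1 Case 2: `∂_{[B_o]}`, `∂_J = ∂_{X^J}`, chunk p0092 L17)] -/
@[simp] theorem brX_zero : brX p e v (0 : ι →₀ ℕ) = 0 := by
  have : bracket p e (0 : ι →₀ ℕ) = 0 := by ext l; simp
  rw [brX, this, Finsupp.mapDomain_zero]

/-- `[B + B'] = [B] + [B']` in the coordinates `x`. [cite: Kawanoue2007, Lemma 4.1.4.1 (proof, Step 1 Case 2: `∂_{[B_o]}`, `∂_J = ∂_{X^J}`, chunk p0092 L17)] -/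
theorem brX_add (B B' : ι →₀ ℕ) : brX p e v (B + B') = brX p e v B + brX p e v B' := by
  rw [brX, bracket_add, Finsupp.mapDomain_add]; rfl

/-- `|[B]|` is the degree of `[B]` in the coordinates `x`. [cite: Kawanoue2007, Lemma 4.1.4.1 (proof, Step 1 Case 2: `∂_{[B_o]}`, `∂_J = ∂_{X^J}`, chunk p0092 L17)] -/
theorem degree_brX (B : ι →₀ ℕ) : (brX p e v B).degree = bracketDeg p e B := by
  rw [← degree_bracket p e B, Finsupp.degree_apply, Finsupp.degree_apply]
  change (brX p e v B).sum (fun _ n => n) = (bracket p e B).sum (fun _ n => n)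
  exact Finsupp.sum_mapDomain_index (fun _ => rfl) (fun _ _ _ => rfl)

/-- `[B − K] = [B] − [K]` in the coordinates `x`. [cite: Kawanoue2007, Lemma 4.1.4.1 (proof, Step 1 Case 2: `∂_{[B_o]}`, `∂_J = ∂_{X^J}`, chunk p0092 L17)] -/
theorem brX_tsub (hv : Function.Injective v) (K B : ι →₀ ℕ) :
    brX p e v (B - K) = brX p e v B - brX p e v K := by
  ext i
  by_cases hi : i ∈ Set.range v
  · obtain ⟨l, rfl⟩ := hi
    simp only [Finsupp.coe_tsub, Pi.sub_apply, brX_apply p e v hv, Nat.sub_mul]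
  · simp only [Finsupp.coe_tsub, Pi.sub_apply, brX_apply_of_not_mem p e v hi]

/-- `K ≤ B ⇒ [K] ≤ [B]` in the coordinates `x`. [cite: Kawanoue2007, Lemma 4.1.4.1 (proof, Step 1 Case 2: `∂_{[B_o]}`, `∂_J = ∂_{X^J}`, chunk p0092 L17)] -/
theorem brX_mono {K B : ι →₀ ℕ} (hKB : K ≤ B) : brX p e v K ≤ brX p e v B := by
  rw [brX, brX]
  exact Finsupp.mapDomain_mono (bracket_mono p e hKB)

/-- `B ↦ [B]` (coordinates `x`) is injective (`p ≥ 1`, `v` injective). [cite: Kawanoue2007, Lemma 4.1.4.1 (proof, Step 1 Case 2: `∂_{[B_o]}`, `∂_J = ∂_{X^J}`, chunk p0092 L17)] -/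
theorem brX_injective (hp : 0 < p) (hv : Function.Injective v) :
    Function.Injective (brX p e v : (ι →₀ ℕ) → Fin d →₀ ℕ) := fun _ _ hBB' =>
  bracket_injective p e hp (Finsupp.mapDomain_injective hv hBB')

/-- A multi-index `J ≤ [B₀]` vanishes off the coordinates `x_{v l}`. [cite: Kawanoue2007, Lemma 4.1.4.1 (proof, Step 1 Case 2: `∂_{[B_o]}`, `∂_J = ∂_{X^J}`, chunk p0092 L17)] -/
theorem eq_zero_of_le_brX {J : Fin d →₀ ℕ} {B₀ : ι →₀ ℕ} (hJ : J ≤ brX p e v B₀) {i : Fin d}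
    (hi : i ∉ Set.range v) : J i = 0 :=
  Nat.eq_zero_of_le_zero (by simpa [brX_apply_of_not_mem p e v hi] using hJ i)

/-- The candidate `K` with `J = [K]`: `K_l = J_{v l} / p^{e_l}`.
[cite: Kawanoue2007, Lemma 4.1.4.1 (proof, Step 1 Case 2: «unless `J = [K]` for some `K ≤ B_o`», chunk p0092 L21)] -/
def divb (J : Fin d →₀ ℕ) : ι →₀ ℕ := Finsupp.equivFunOnFinite.symm fun l => J (v l) / p ^ e l

/-- `(divb J)_l = J_{v l} / p^{e_l}`. [cite: Kawanoue2007, Lemma 4.1.4.1 (proof, Step 1 Case 2: «unless `J = [K]` for some `K ≤ B_o`», chunk p0092 L21)] -/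
@[simp] theorem divb_apply (J : Fin d →₀ ℕ) (l : ι) : divb p e v J l = J (v l) / p ^ e l := by
  simp [divb]

/-- If every `J_{v l}` is divisible by `p^{e_l}` (and `J ≤ [B₀]`), then `J = [K]` with `K = divb J`.
[cite: Kawanoue2007, Lemma 4.1.4.1 (proof, Step 1 Case 2: «unless `J = [K]` for some `K ≤ B_o`»)] -/
theorem brX_divb (hv : Function.Injective v) {J : Fin d →₀ ℕ} {B₀ : ι →₀ ℕ} (hJ : J ≤ brX p e v B₀)
    (hdvd : ∀ l, p ^ e l ∣ J (v l)) : brX p e v (divb p e v J) = J := by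
  ext i
  by_cases hi : i ∈ Set.range v
  · obtain ⟨l, rfl⟩ := hi
    rw [brX_apply p e v hv, divb_apply, Nat.div_mul_cancel (hdvd l)]
  · rw [brX_apply_of_not_mem p e v hi, eq_zero_of_le_brX p e v hJ hi]

/-- `J ≤ [B₀] ⇒ divb J ≤ B₀` («for some `K ≤ B_o`»). [cite: Kawanoue2007, Lemma 4.1.4.1 (proof, Step 1 Case 2: «unless `J = [K]` for some `K ≤ B_o`», chunk p0092 L21)] -/
theorem divb_le (hp : 0 < p) (hv : Function.Injective v) {J : Fin d →₀ ℕ} {B₀ : ι →₀ ℕ}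
    (hJ : J ≤ brX p e v B₀) : divb p e v J ≤ B₀ := by
  intro l
  simp only [divb_apply]
  have h1 := hJ (v l)
  rw [brX_apply p e v hv] at h1
  exact (Nat.div_le_div_right h1).trans_eq (Nat.mul_div_cancel _ (pow_pos hp _))

variable (x : Fin d → R)

/-- `X^M = ∏_i x_i^{M_i}`.
[cite: Kawanoue2007, Lemma 4.1.4.1 (proof, Step 1 Case 2: `X^{[B]}`, `∂_J X^{[B]} = ([B] over J) X^{[B]−J}`, chunk p0092 L19)] -/
def xPow (M : Fin d →₀ ℕ) : R := ∏ i, x i ^ M i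

/-- `X^0 = 1`. [cite: Kawanoue2007, Lemma 4.1.4.1 (proof, Step 1 Case 2: `X^{[B]}`, `∂_J X^{[B]} = ([B] over J) X^{[B]−J}`, chunk p0092 L19)] -/
@[simp] theorem xPow_zero : xPow x (0 : Fin d →₀ ℕ) = 1 := by simp [xPow]

/-- `X^{M+N} = X^M X^N`. [cite: Kawanoue2007, Lemma 4.1.4.1 (proof, Step 1 Case 2: `X^{[B]}`, `∂_J X^{[B]} = ([B] over J) X^{[B]−J}`, chunk p0092 L19)] -/
theorem xPow_add (M N : Fin d →₀ ℕ) : xPow x (M + N) = xPow x M * xPow x N := by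
  simp only [xPow, Finsupp.coe_add, Pi.add_apply, pow_add, Finset.prod_mul_distrib]

/-- `X^{[B]} = ∏_l x_{v l}^{b_l p^{e_l}}`.
[cite: Kawanoue2007, Lemma 4.1.4.1 (proof, Step 1 Case 2: `X^{[B]}`, `∂_J X^{[B]} = ([B] over J) X^{[B]−J}`, chunk p0092 L19)] -/
theorem xPow_brX (hv : Function.Injective v) (B : ι →₀ ℕ) :
    xPow x (brX p e v B) = ∏ l, x (v l) ^ (B l * p ^ e l) := by
  classical
  rw [xPow, ← Finset.prod_subset (Finset.subset_univ (Finset.univ.image v))]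
  · rw [Finset.prod_image fun a _ b _ hab => hv hab]
    exact Finset.prod_congr rfl fun l _ => by rw [brX_apply p e v hv]
  · intro i _ hi
    rw [brX_apply_of_not_mem p e v, pow_zero]
    intro ⟨l, hl⟩
    exact hi (Finset.mem_image.mpr ⟨l, Finset.mem_univ l, hl⟩)

variable [IsLocalRing R]

/-- `X^M ∈ 𝔪^{|M|}`.
[cite: Kawanoue2007, Lemma 4.1.4.1 (proof, Step 1 Case 2: `X^{[B]}`, `∂_J X^{[B]} = ([B] over J) X^{[B]−J}`, chunk p0092 L19)] -/
theorem xPow_mem_pow (hx : ∀ i, x i ∈ maximalIdeal R) (M : Fin d →₀ ℕ) :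
    xPow x M ∈ maximalIdeal R ^ M.degree := by
  rw [xPow, Finsupp.degree_eq_sum, ← Finset.prod_pow_eq_pow_sum]
  exact Ideal.prod_mem_prod fun i _ => Ideal.pow_mem_pow (hx i) _

omit [Fintype ι] in
/-- Products of congruences: `a_l ≡ b_l mod 𝔪^{n_l+1}`, `b_l ∈ 𝔪^{n_l}` ⇒ `∏ a_l ≡ ∏ b_l mod 𝔪^{∑ n_l + 1}`. [folklore] -/
private theorem prod_sub_prod_mem_pow_succ {s : Finset ι} {a b : ι → R} {n : ι → ℕ}
    (hb : ∀ l ∈ s, b l ∈ maximalIdeal R ^ n l) (hab : ∀ l ∈ s, a l - b l ∈ maximalIdeal R ^ (n l + 1)) :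
    ∏ l ∈ s, a l - ∏ l ∈ s, b l ∈ maximalIdeal R ^ (∑ l ∈ s, n l + 1) := by
  classical
  induction s using Finset.induction_on with
  | empty => simp
  | @insert i s hi ih =>
    rw [Finset.prod_insert hi, Finset.prod_insert hi, Finset.sum_insert hi]
    have ha : a i ∈ maximalIdeal R ^ n i := by
      simpa using add_mem (Ideal.pow_le_pow_right (Nat.le_succ _) (hab i (Finset.mem_insert_self i s)))
        (hb i (Finset.mem_insert_self i s))
    have e1 : a i * ∏ l ∈ s, a l - b i * ∏ l ∈ s, b l =
        a i * (∏ l ∈ s, a l - ∏ l ∈ s, b l) + (a i - b i) * ∏ l ∈ s, b l := by ring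
    rw [e1]
    refine add_mem ?_ ?_
    · have := Ideal.mul_mem_mul ha (ih (fun l hl => hb l (Finset.mem_insert_of_mem hl))
        (fun l hl => hab l (Finset.mem_insert_of_mem hl)))
      rw [← pow_add] at this
      convert this using 2; ring
    · have := Ideal.mul_mem_mul (hab i (Finset.mem_insert_self i s))
        (Ideal.prod_mem_prod (s := s) fun l hl => hb l (Finset.mem_insert_of_mem hl))
      rw [Finset.prod_pow_eq_pow_sum, ← pow_add] at this
      convert this using 2; ring

variable (h : ι → R)

/-- **`H^B ≡ X^{[B]} mod 𝔪^{|[B]|+1}`** in adapted coordinates `h_l ≡ x_{v l}^{p^{e_l}} mod 𝔪^{p^{e_l}+1}`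
(«`≡ ∑ … (∂_J X^{[B]})`», p0092 L10–L12). [cite: Kawanoue2007, Lemma 4.1.4.1 (proof, Step 1 Case 2)] -/
theorem hPow_sub_xPow_mem (hv : Function.Injective v) (hx : ∀ i, x i ∈ maximalIdeal R)
    (hh : ∀ l, h l - x (v l) ^ p ^ e l ∈ maximalIdeal R ^ (p ^ e l + 1)) (B : ι →₀ ℕ) :
    hPow h B - xPow x (brX p e v B) ∈ maximalIdeal R ^ (bracketDeg p e B + 1) := by
  rw [xPow_brX p e v x hv, hPow, bracketDeg]
  refine prod_sub_prod_mem_pow_succ (fun l _ => ?_) (fun l _ => ?_)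
  · exact Ideal.pow_mem_pow (hx _) _
  · have h1 := pow_sub_pow_mem_mpow_succ (Ideal.pow_mem_pow (hx (v l)) (p ^ e l)) (hh l) (B l)
    rwa [← pow_mul, mul_comm (p ^ e l) (B l)] at h1

end Coordinates

/-! ## Step 1 Case 2: the binomial coefficients of `∂_J X^{[B]}` -/

section Coefficients

variable {R : Type u} [CommRing R] (p : ℕ) [ExpChar R p]
variable {ι : Type*} [Fintype ι] (e : ι → ℕ) {d : ℕ} (v : ι → Fin d)

/-- The divided-power coefficient `∏_{i ∈ supp J} (β_i over J_i)` is the full product `∏_i (β_i over J_i)`. [folklore] -/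
private theorem prod_support_choose_eq (J β : Fin d →₀ ℕ) :
    (∏ i ∈ J.support, (β i).choose (J i)) = ∏ i, (β i).choose (J i) := by
  classical
  refine Finset.prod_subset (Finset.subset_univ _) fun i _ hi => ?_
  rw [Finsupp.notMem_support_iff.mp hi, Nat.choose_zero_right]

/-- Reindexing the coefficient of `∂_J X^{[B]}` through `v` (for `J` supported on the image of `v`). [folklore] -/
private theorem prod_choose_brX_eq (hv : Function.Injective v) {J : Fin d →₀ ℕ} (hJ : ∀ i ∉ Set.range v, J i = 0)
    (B : ι →₀ ℕ) : (∏ i, ((brX p e v B) i).choose (J i)) = ∏ l, (B l * p ^ e l).choose (J (v l)) := by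
  classical
  rw [← Finset.prod_subset (Finset.subset_univ (Finset.univ.image v))]
  · rw [Finset.prod_image fun a _ b _ hab => hv hab]
    exact Finset.prod_congr rfl fun l _ => by rw [brX_apply p e v hv]
  · intro i _ hi
    have hi' : i ∉ Set.range v := fun ⟨l, hl⟩ => hi (Finset.mem_image.mpr ⟨l, Finset.mem_univ l, hl⟩)
    rw [brX_apply_of_not_mem p e v hi', hJ i hi', Nat.choose_zero_right]

/-- **Lucas, first use**: `([B] over J) = 0` in `R` unless every `J_{v l}` is divisible by `p^{e_l}`
(«the binomial coefficient `([B] over J)` is zero unless `J = [K]`», p0092 L14).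
[cite: Kawanoue2007, Lemma 4.1.4.1 (proof, Step 1 Case 2)] -/
theorem cast_coef_eq_zero (hv : Function.Injective v) {J : Fin d →₀ ℕ} (hJ : ∀ i ∉ Set.range v, J i = 0)
    (B : ι →₀ ℕ) {l : ι} (hl : ¬ p ^ e l ∣ J (v l)) :
    ((∏ i ∈ J.support, ((brX p e v B) i).choose (J i) : ℕ) : R) = 0 := by
  rw [prod_support_choose_eq, prod_choose_brX_eq p e v hv hJ, Nat.cast_prod]
  exact Finset.prod_eq_zero (Finset.mem_univ l) (cast_choose_mul_pow_eq_zero p (e l) (B l) _ hl)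

/-- **Lucas, second use**: for `J = [K]`, `([B] over [K]) = (B over K)` in `R` (p0092 L16–L18).
[cite: Kawanoue2007, Lemma 4.1.4.1 (proof, Step 1 Case 2)] -/
theorem cast_coef_eq_prod (hv : Function.Injective v) {J : Fin d →₀ ℕ} (hJ : ∀ i ∉ Set.range v, J i = 0)
    (B : ι →₀ ℕ) (hdvd : ∀ l, p ^ e l ∣ J (v l)) :
    ((∏ i ∈ J.support, ((brX p e v B) i).choose (J i) : ℕ) : R) =
      ∏ l, (((B l).choose (divb p e v J l) : ℕ) : R) := by
  rw [prod_support_choose_eq, prod_choose_brX_eq p e v hv hJ, Nat.cast_prod]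
  refine Finset.prod_congr rfl fun l _ => ?_
  rw [divb_apply, ← cast_choose_mul_pow_mul_pow p (e l) (B l) (J (v l) / p ^ e l),
    Nat.div_mul_cancel (hdvd l)]

omit [ExpChar R p] in
/-- `(B over K) = 0` unless `K ≤ B` («the binomial coefficient `(B over K) = 0` unless `K ≤ B`», p0092 L20). [folklore] -/
private theorem prod_cast_choose_eq_zero {K B : ι →₀ ℕ} (hKB : ¬ K ≤ B) :
    ∏ l, (((B l).choose (K l) : ℕ) : R) = 0 := by
  obtain ⟨l, hl⟩ : ∃ l, B l < K l := by
    by_contra hcon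
    exact hKB fun l => not_lt.mp fun h' => hcon ⟨l, h'⟩
  exact Finset.prod_eq_zero (Finset.mem_univ l) (by rw [Nat.choose_eq_zero_of_lt hl, Nat.cast_zero])

omit [ExpChar R p] in
/-- `(B over B) = 1`. [folklore] -/
private theorem prod_cast_choose_self (B : ι →₀ ℕ) : ∏ l, (((B l).choose (B l) : ℕ) : R) = 1 :=
  Finset.prod_eq_one fun l _ => by rw [Nat.choose_self, Nat.cast_one]

end Coefficients

/-! ## Step 1 Case 2: the Hasse–Schmidt computation `∂_{[B_o]}(α_B H^B)` modulo `𝔪^{r−c+2}` (p0092) -/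

section Engine

variable {k : Type*} [CommRing k] {R : Type u} [CommRing R] [IsLocalRing R] [Algebra k R]
variable (p : ℕ) [ExpChar R p] {ι : Type*} [Fintype ι] [DecidableEq ι] (h : ι → R) (e : ι → ℕ)
variable {d : ℕ} (x : Fin d → R) (v : ι → Fin d)

/-- **One term of `∂_{[B_o]}(α H^B)`** (generalized product rule, p0092 L8–L26): for
`(J₁, J₂)` with `J₁ + J₂ = [B_o]`, `α ∈ 𝔪^{r−|[B]|}`, `|[B]| ≥ |[B_o]| = c − 1`, the product
`∂_{J₁}(α) · ∂_{J₂}(H^B)` lies in `∑_{|[B']| ≥ 1} 𝔪^{r−c+1−|[B']|} H^{B'} + 𝔪^{r−c+2}`, except for the term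
`J₁ = 0`, `B = B_o`, which is `≡ α`. Ingredients: `H^B ≡ X^{[B]}`, the exact values
`∂_J X^{[B]} = ([B] over J) X^{[B]−J}`, Lucas (`([B] over J) = 0` unless `J = [K]`, `([B] over [K]) = (B over K)`),
and `K = B ⇒ B = B_o`. Truncated natural subtraction realises the printed exponents (all `≥ 0` in print).
[cite: Kawanoue2007, Lemma 4.1.4.1 (proof, Step 1 Case 2, (*))] -/
theorem term_sub_mem (hp : 0 < p) (hv : Function.Injective v) (hx : ∀ i, x i ∈ maximalIdeal R)
    (hh : ∀ l, h l - x (v l) ^ p ^ e l ∈ maximalIdeal R ^ (p ^ e l + 1))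
    {n : ℕ} (Δ : (Fin d →₀ ℕ) → (R →ₗ[k] R)) (h0 : ∀ b, Δ 0 b = b)
    (hval : ∀ q β : Fin d →₀ ℕ, q.degree ≤ n →
      Δ q (∏ i, x i ^ β i) = ((∏ i ∈ q.support, (β i).choose (q i) : ℕ) : R) * ∏ i, x i ^ (β - q) i)
    (hord : ∀ q : Fin d →₀ ℕ, q.degree ≤ n → ∀ (m : ℕ) (f : R), f ∈ maximalIdeal R ^ m →
      Δ q f ∈ maximalIdeal R ^ (m - q.degree))
    {B₀ : ι →₀ ℕ} (hB₀n : bracketDeg p e B₀ ≤ n) (r : ℕ)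
    {B : ι →₀ ℕ} (hB : bracketDeg p e B₀ ≤ bracketDeg p e B) {α : R}
    (hα : α ∈ maximalIdeal R ^ (r - bracketDeg p e B))
    {P : (Fin d →₀ ℕ) × (Fin d →₀ ℕ)} (hP : P ∈ Finset.antidiagonal (brX p e v B₀)) :
    Δ P.1 α * Δ P.2 (hPow h B) - (if B = B₀ ∧ P.1 = 0 then α else 0) ∈
      tailIdeal p h e 1 (r - bracketDeg p e B₀) ⊔ maximalIdeal R ^ (r + 1 - bracketDeg p e B₀) := by
  classical
  rw [Finset.mem_antidiagonal] at hP
  -- degrees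
  have hdeg : P.1.degree + P.2.degree = bracketDeg p e B₀ := by
    rw [← map_add, hP, degree_brX]
  have hP1n : P.1.degree ≤ n := by omega
  have hP2n : P.2.degree ≤ n := by omega
  have hP2le : P.2 ≤ brX p e v B₀ := hP ▸ le_add_self
  have hP2supp : ∀ i ∉ Set.range v, P.2 i = 0 := fun i hi => eq_zero_of_le_brX p e v hP2le hi
  have hP1_of : P.1 = 0 → P.2 = brX p e v B₀ := fun hP1 => by simpa [hP1] using hP
  -- order of `∂_{J₁} α`
  have hα' : Δ P.1 α ∈ maximalIdeal R ^ (r - bracketDeg p e B - P.1.degree) := hord P.1 hP1n _ _ hα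
  -- the error term `∂_{J₁} α · ∂_{J₂}(H^B − X^{[B]})`
  have herr : Δ P.1 α * Δ P.2 (hPow h B - xPow x (brX p e v B)) ∈
      maximalIdeal R ^ (r + 1 - bracketDeg p e B₀) := by
    have h2 := hord P.2 hP2n _ _ (hPow_sub_xPow_mem p e v x h hv hx hh B)
    have := mul_mem_mpow_add hα' h2
    exact Ideal.pow_le_pow_right (by omega) this
  have e1 : Δ P.1 α * Δ P.2 (hPow h B) - (if B = B₀ ∧ P.1 = 0 then α else 0) =
      (Δ P.1 α * Δ P.2 (xPow x (brX p e v B)) - (if B = B₀ ∧ P.1 = 0 then α else 0)) +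
        Δ P.1 α * Δ P.2 (hPow h B - xPow x (brX p e v B)) := by
    rw [map_sub]; ring
  rw [e1]
  refine add_mem ?_ (Ideal.mem_sup_right herr)
  -- the main term: exact values of `∂_{J₂}` on `X^{[B]}`
  rw [xPow, hval P.2 (brX p e v B) hP2n]
  by_cases hdvd : ∀ l, p ^ e l ∣ P.2 (v l)
  · -- `J₂ = [K]` with `K ≤ B₀`
    set K := divb p e v P.2 with hK
    have hKP : brX p e v K = P.2 := brX_divb p e v hv hP2le hdvd
    have hKB₀ : K ≤ B₀ := divb_le p e v hp hv hP2le
    have hdegK : P.2.degree = bracketDeg p e K := by rw [← hKP, degree_brX]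
    have hK_of : P.1 = 0 → K = B₀ := fun hP1 =>
      brX_injective p e v hp hv (hKP.trans (hP1_of hP1))
    rw [cast_coef_eq_prod p e v hv hP2supp B hdvd]
    change Δ P.1 α * ((∏ l, (((B l).choose (K l) : ℕ) : R)) * ∏ i, x i ^ (brX p e v B - P.2) i) - _ ∈ _
    by_cases hKB : K ≤ B
    · have hX : (∏ i, x i ^ (brX p e v B - P.2) i) = xPow x (brX p e v (B - K)) := by
        rw [brX_tsub p e v hv, hKP]; rfl
      rw [hX]
      by_cases hKeq : K = B
      · -- the diagonal term: `B = B₀`, `J₁ = 0`, value `α`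
        have hBB₀ : B = B₀ := eq_of_le_of_bracketDeg_le p e hp (hKeq ▸ hKB₀) hB
        have hP2 : P.2 = brX p e v B₀ := by rw [← hKP, hKeq, hBB₀]
        have hP1 : P.1 = 0 := by
          have h5 : P.1 + P.2 = P.2 := by rw [hP, hP2]
          simpa using congrArg (fun q => q - P.2) h5
        have hsub : B - K = 0 := by rw [hKeq, tsub_self]
        rw [if_pos ⟨hBB₀, hP1⟩, hP1, h0, hsub, brX_zero, xPow_zero, hKeq, prod_cast_choose_self, mul_one,
          mul_one, sub_self]
        exact zero_mem _
      · -- `K < B`: the term lies in `𝔪^{…} H^{B−K} + 𝔪^{r+1−|[B₀]|}`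
        have hne : ¬ (B = B₀ ∧ P.1 = 0) := fun ⟨hBB₀, hP1⟩ => hKeq ((hK_of hP1).trans hBB₀.symm)
        rw [if_neg hne, sub_zero]
        have hdegBK : bracketDeg p e (B - K) + bracketDeg p e K = bracketDeg p e B := by
          rw [← bracketDeg_add, tsub_add_cancel_of_le hKB]
        have hBK1 : 1 ≤ bracketDeg p e (B - K) :=
          bracketDeg_pos p e hp fun h0' => hKeq (le_antisymm hKB (tsub_eq_zero_iff_le.mp h0'))
        have e2 : Δ P.1 α * ((∏ l, (((B l).choose (K l) : ℕ) : R)) * xPow x (brX p e v (B - K))) =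
            Δ P.1 α * (∏ l, (((B l).choose (K l) : ℕ) : R)) * hPow h (B - K) -
              Δ P.1 α * (∏ l, (((B l).choose (K l) : ℕ) : R)) *
                (hPow h (B - K) - xPow x (brX p e v (B - K))) := by ring
        rw [e2]
        refine sub_mem (Ideal.mem_sup_left ?_) (Ideal.mem_sup_right ?_)
        · refine pow_mul_span_le_tailIdeal p h e (r - bracketDeg p e B₀) hBK1 ?_
          refine Ideal.mul_mem_mul ?_ (Ideal.mem_span_singleton_self _)
          exact Ideal.mul_mem_right _ _ (Ideal.pow_le_pow_right (by omega) hα')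
        · have h3 := hPow_sub_xPow_mem p e v x h hv hx hh (B - K)
          have := mul_mem_mpow_add
            (Ideal.mul_mem_right (∏ l, (((B l).choose (K l) : ℕ) : R)) _ hα') h3
          exact Ideal.pow_le_pow_right (by omega) this
    · -- `K ≰ B`: the coefficient `(B over K)` vanishes
      have hne : ¬ (B = B₀ ∧ P.1 = 0) := fun ⟨hBB₀, hP1⟩ =>
        hKB (((hK_of hP1).trans hBB₀.symm).le)
      rw [prod_cast_choose_eq_zero (R := R) hKB, if_neg hne]
      simp
  · -- `J₂` is not of the form `[K]`: `([B] over J₂) = 0` by Lucas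
    obtain ⟨l, hl⟩ := not_forall.mp hdvd
    have hne : ¬ (B = B₀ ∧ P.1 = 0) := by
      rintro ⟨-, hP1⟩
      apply hl
      rw [hP1_of hP1, brX_apply p e v hv]
      exact Dvd.intro_left _ rfl
    rw [cast_coef_eq_zero p e v hv hP2supp B hl, if_neg hne]
    simp

/-- **(*) of p0092 L26**: `∂_{[B_o]}(α H^B) − [B = B_o] α ∈ ∑_{|[B']| ≥ 1} 𝔪^{r−c+1−|[B']|} H^{B'} + 𝔪^{r−c+2}`
(`c − 1 = |[B_o]| ≤ |[B]|`, `α ∈ 𝔪^{r−|[B]|}`), summing `term_sub_mem` over the generalized product rule.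
[cite: Kawanoue2007, Lemma 4.1.4.1 (proof, Step 1 Case 2, (*))] -/
theorem apply_mul_hPow_sub_mem (hp : 0 < p) (hv : Function.Injective v) (hx : ∀ i, x i ∈ maximalIdeal R)
    (hh : ∀ l, h l - x (v l) ^ p ^ e l ∈ maximalIdeal R ^ (p ^ e l + 1))
    {n : ℕ} (Δ : (Fin d →₀ ℕ) → (R →ₗ[k] R)) (h0 : ∀ b, Δ 0 b = b)
    (hmul : ∀ q : Fin d →₀ ℕ, q.degree ≤ n →
      ∀ f g : R, Δ q (f * g) = ∑ P ∈ Finset.antidiagonal q, Δ P.1 f * Δ P.2 g)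
    (hval : ∀ q β : Fin d →₀ ℕ, q.degree ≤ n →
      Δ q (∏ i, x i ^ β i) = ((∏ i ∈ q.support, (β i).choose (q i) : ℕ) : R) * ∏ i, x i ^ (β - q) i)
    (hord : ∀ q : Fin d →₀ ℕ, q.degree ≤ n → ∀ (m : ℕ) (f : R), f ∈ maximalIdeal R ^ m →
      Δ q f ∈ maximalIdeal R ^ (m - q.degree))
    {B₀ : ι →₀ ℕ} (hB₀n : bracketDeg p e B₀ ≤ n) (r : ℕ)
    {B : ι →₀ ℕ} (hB : bracketDeg p e B₀ ≤ bracketDeg p e B) {α : R}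
    (hα : α ∈ maximalIdeal R ^ (r - bracketDeg p e B)) :
    Δ (brX p e v B₀) (α * hPow h B) - (if B = B₀ then α else 0) ∈
      tailIdeal p h e 1 (r - bracketDeg p e B₀) ⊔ maximalIdeal R ^ (r + 1 - bracketDeg p e B₀) := by
  classical
  have hdegn : (brX p e v B₀).degree ≤ n := by rwa [degree_brX]
  rw [hmul _ hdegn]
  -- the subtracted `α` is the `P = (0, [B₀])` instance of the per-term correction
  have hite : (if B = B₀ then α else 0) =
      ∑ P ∈ Finset.antidiagonal (brX p e v B₀), (if B = B₀ ∧ P.1 = 0 then α else 0) := by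
    have e1 : ∀ P ∈ Finset.antidiagonal (brX p e v B₀),
        (if B = B₀ ∧ P.1 = 0 then α else 0) =
          if P = (0, brX p e v B₀) then (if B = B₀ then α else 0) else 0 := by
      intro P hP
      rw [Finset.mem_antidiagonal] at hP
      by_cases hP1 : P.1 = 0
      · have hP' : P = (0, brX p e v B₀) := by
          ext1
          · exact hP1
          · simpa [hP1] using hP
        simp [hP']
      · have hP' : P ≠ (0, brX p e v B₀) := fun h' => hP1 (by rw [h'])
        simp [hP1, hP']
    rw [Finset.sum_congr rfl e1, Finset.sum_ite_eq']
    rw [if_pos (Finset.mem_antidiagonal.mpr (zero_add _))]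
  rw [hite, ← Finset.sum_sub_distrib]
  exact sum_mem fun P hP =>
    term_sub_mem p h e x v hp hv hx hh Δ h0 hval hord hB₀n r hB hα hP

end Engine

/-! ## Step 1: the induction on `c` (Case 2 assembled) -/

section StepOneInduction

variable {R : Type u} [CommRing R] [IsLocalRing R]
variable (p : ℕ) {ι : Type*} [Fintype ι] (h : ι → R) (e : ι → ℕ)

/-- The tail lies in `𝔪^r` (`𝔪^{r−|[B]|} H^B ⊆ 𝔪^r` as `H^B ∈ 𝔪^{|[B]|}`).
[cite: Kawanoue2007, Lemma 4.1.4.1 (proof, Step 1: `J_{c,r}`, chunk p0091 L27)] -/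
theorem tailIdeal_le_pow (pow_mem : ∀ l, h l ∈ maximalIdeal R ^ p ^ e l) (c r : ℕ) :
    tailIdeal p h e c r ≤ maximalIdeal R ^ r := by
  refine iSup₂_le fun B _ => ?_
  rw [Ideal.mul_le]
  intro a ha b hb
  obtain ⟨b, rfl⟩ := Ideal.mem_span_singleton'.mp hb
  rw [mul_comm b, ← mul_assoc]
  refine Ideal.mul_mem_right _ _ (Ideal.pow_le_pow_right ?_ (mul_mem_mpow_add ha (hPow_mem_pow p h e pow_mem B)))
  omega

/-- **Shift of the tail**: `(∑_{|[B']| ≥ 1} 𝔪^{(r−c)−|[B']|} H^{B'}) · H^{B₀} ⊆ ∑_{|[B]| ≥ c+1} 𝔪^{r−|[B]|} H^B` for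
`|[B₀]| = c` («`∑_{|[B]|≥1} 𝔪^{r−c+1−|[B]|} H^{B+B_o} ⊂ ∑_{|[B+B_o]| ≥ c} …`», p0093 L2–L4).
[cite: Kawanoue2007, Lemma 4.1.4.1 (proof, Step 1 Case 2)] -/
theorem tailIdeal_mul_span_hPow_le {c : ℕ} {B₀ : ι →₀ ℕ} (hB₀ : bracketDeg p e B₀ = c) (r : ℕ) :
    tailIdeal p h e 1 (r - c) * Ideal.span {hPow h B₀} ≤ tailIdeal p h e (c + 1) r := by
  rw [tailIdeal]
  simp only [Ideal.iSup_mul]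
  refine iSup₂_le fun B' hB' => ?_
  rw [mul_assoc, Ideal.span_singleton_mul_span_singleton, ← hPow_add]
  have hdeg : bracketDeg p e (B' + B₀) = bracketDeg p e B' + c := by rw [bracketDeg_add, hB₀]
  have hexp : r - c - bracketDeg p e B' = r - bracketDeg p e (B' + B₀) := by rw [hdeg]; omega
  rw [hexp]
  exact pow_mul_span_le_tailIdeal p h e r (by omega)

/-- **Finite representation of an element of the tail**: `t = ∑_B α_B H^B` with finitely many `α_B ≠ 0`, all with
`|[B]| ≥ c` and `α_B ∈ 𝔪^{r−|[B]|}` («there exists a finite set `{α_B ∈ 𝔪^{r−|[B]|} ; |[B]| ≥ c − 1}`»,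
p0092 L3–L6). [cite: Kawanoue2007, Lemma 4.1.4.1 (proof, Step 1 Case 2)] -/
theorem exists_finsupp_of_mem_tailIdeal {c r : ℕ} {t : R} (ht : t ∈ tailIdeal p h e c r) :
    ∃ α : (ι →₀ ℕ) →₀ R, (∀ B ∈ α.support, c ≤ bracketDeg p e B) ∧
      (∀ B, α B ∈ maximalIdeal R ^ (r - bracketDeg p e B)) ∧ t = α.sum fun B a => a * hPow h B := by
  classical
  refine Submodule.iSup_induction
    (fun B : ι →₀ ℕ => ⨆ (_ : c ≤ bracketDeg p e B),
      maximalIdeal R ^ (r - bracketDeg p e B) * Ideal.span {hPow h B})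
    (motive := fun t => ∃ α : (ι →₀ ℕ) →₀ R, (∀ B ∈ α.support, c ≤ bracketDeg p e B) ∧
      (∀ B, α B ∈ maximalIdeal R ^ (r - bracketDeg p e B)) ∧ t = α.sum fun B a => a * hPow h B)
    ht ?_ ?_ ?_
  · intro B y hy
    by_cases hc : c ≤ bracketDeg p e B
    · rw [iSup_pos hc, Ideal.mem_mul_span_singleton] at hy
      obtain ⟨z, hz, rfl⟩ := hy
      refine ⟨Finsupp.single B z, fun B' hB' => ?_, fun B' => ?_, ?_⟩
      · rw [Finset.mem_singleton.mp (Finsupp.support_single_subset hB')]; exact hc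
      · by_cases hBB' : B' = B
        · subst hBB'; rwa [Finsupp.single_eq_same]
        · rw [Finsupp.single_eq_of_ne hBB']; exact zero_mem _
      · rw [Finsupp.sum_single_index (by rw [zero_mul])]
    · rw [iSup_neg hc, Submodule.mem_bot] at hy
      subst hy
      exact ⟨0, fun B' hB' => absurd hB' (by simp), fun _ => by simp, by simp⟩
  · exact ⟨0, fun B' hB' => absurd hB' (by simp), fun _ => by simp, by simp⟩
  · rintro y z ⟨α, hαs, hαm, rfl⟩ ⟨β, hβs, hβm, rfl⟩
    refine ⟨α + β, fun B hB => ?_, fun B => ?_, ?_⟩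
    · rcases Finset.mem_union.mp (Finsupp.support_add hB) with hB | hB
      · exact hαs B hB
      · exact hβs B hB
    · rw [Finsupp.add_apply]; exact add_mem (hαm B) (hβm B)
    · rw [Finsupp.sum_add_index' (fun _ => zero_mul _) (fun _ _ _ => add_mul _ _ _)]

end StepOneInduction

section StepOneMain

variable {k : Type*} [CommRing k] {R : Type u} [CommRing R] [IsRegularLocalRing R] [Algebra k R]
variable (p : ℕ) [ExpChar R p] {ι : Type*} [Fintype ι] [DecidableEq ι] (h : ι → R) (e : ι → ℕ)
variable (𝕀 : IdealisticFiltration R) {d : ℕ} (x : Fin d → R) (v : ι → Fin d)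

/-- **Step 1 of the proof of the Coefficient Lemma: the inclusions `(⋆)_{c,r}`** (p0091 L20 – p0093 L12):
for `1 ≤ c ≤ ⌈a⌉`, `a > 0`, and every `r`, `𝕀_a ∩ 𝔪^r ⊆ J_{c,r} = 𝔪^{r+1} + 𝔮_a + ∑_{|[B]| ≥ c} 𝔪^{r−|[B]|} H^B`,
by induction on `c`: Case 1 = `level_inf_pow_le_jIdeal_one` (Supporting Lemma 3); Case 2 applies the differential
operator `∂_{[B_o]}` (a member `Δ_{[B_o]}` of a truncated Hasse–Schmidt system of level `n ≥ c − 1` along the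
adapted regular system of parameters; 𝔇-saturation gives `∂_{[B_o]} f ∈ 𝕀_{a−c+1}`), the computation (*)
(`apply_mul_hPow_sub_mem`) and Case 1 at level `a − c + 1` (**).
[cite: Kawanoue2007, Lemma 4.1.4.1 (proof, Step 1)] -/
theorem level_inf_pow_le_jIdeal (hv : Function.Injective v) (hx : ∀ i, x i ∈ maximalIdeal R)
    (hh : ∀ l, h l - x (v l) ^ p ^ e l ∈ maximalIdeal R ^ (p ^ e l + 1))
    {n : ℕ} (Δ : (Fin d →₀ ℕ) → (R →ₗ[k] R)) (h0 : ∀ b, Δ 0 b = b)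
    (hmul : ∀ q : Fin d →₀ ℕ, q.degree ≤ n →
      ∀ f g : R, Δ q (f * g) = ∑ P ∈ Finset.antidiagonal q, Δ P.1 f * Δ P.2 g)
    (hval : ∀ q β : Fin d →₀ ℕ, q.degree ≤ n →
      Δ q (∏ i, x i ^ β i) = ((∏ i ∈ q.support, (β i).choose (q i) : ℕ) : R) * ∏ i, x i ^ (β - q) i)
    (hdiff : ∀ q : Fin d →₀ ℕ, q.degree ≤ n → IsDiffOpLE k q.degree (Δ q))
    (hD : 𝕀.IsDSaturated k) (H : IsWeakLGS p 𝕀 h e) {μ : ℝ} (hμ0 : 0 ≤ μ)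
    (hμ : ENNReal.ofReal μ < muTilde 𝕀 h) :
    ∀ c : ℕ, 1 ≤ c → c ≤ n + 1 → ∀ a : ℝ, 0 < a → c ≤ ⌈a⌉₊ → ∀ r : ℕ,
      𝕀.level a ⊓ maximalIdeal R ^ r ≤ jIdeal p h e 𝕀 μ a c r := by
  have hp : 0 < p := expChar_pos R p
  have hord : ∀ q : Fin d →₀ ℕ, q.degree ≤ n → ∀ (m : ℕ) (f : R), f ∈ maximalIdeal R ^ m →
      Δ q f ∈ maximalIdeal R ^ (m - q.degree) :=
    fun q hq m f hf => (hdiff q hq).apply_mem_pow_sub (maximalIdeal R) m hf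
  intro c hc
  induction c, hc using Nat.le_induction with
  | base =>
    intro _ a ha _ r
    exact level_inf_pow_le_jIdeal_one p h e 𝕀 H hμ0 hμ ha r
  | succ c hc IH =>
    intro hcn a ha hca r f hf
    obtain ⟨hfa, hfr⟩ := hf
    have hIH : f ∈ jIdeal p h e 𝕀 μ a c r := IH (by omega) a ha (by omega) r ⟨hfa, hfr⟩
    -- `f = m + q + t`, `m ∈ 𝔪^{r+1}`, `q ∈ 𝔮_a`, `t ∈ tail(c, r)`
    obtain ⟨y, hy, t, ht, rfl⟩ := Submodule.mem_sup.mp hIH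
    obtain ⟨m, hm, q, hq, rfl⟩ := Submodule.mem_sup.mp hy
    have hqI : q ∈ 𝕀.level a := qIdeal_le_level p h e 𝕀 H.level_mem μ a hq
    -- it suffices to treat `f' = m + t ∈ 𝕀_a ∩ 𝔪^r`
    have hf'a : m + t ∈ 𝕀.level a := by
      have : m + q + t - q ∈ 𝕀.level a := sub_mem hfa hqI
      convert this using 1; ring
    have hf'r : m + t ∈ maximalIdeal R ^ r :=
      add_mem (Ideal.pow_le_pow_right (Nat.le_succ r) hm) (tailIdeal_le_pow p h e H.pow_mem c r ht)
    suffices hmt : m + t ∈ jIdeal p h e 𝕀 μ a (c + 1) r by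
      have e1 : m + q + t = (m + t) + q := by ring
      rw [e1]
      exact add_mem hmt (Ideal.mem_sup_left (Ideal.mem_sup_right hq))
    -- finite representation of `t`
    obtain ⟨α, hαs, hαm, rfl⟩ := exists_finsupp_of_mem_tailIdeal p h e ht
    -- positivity of `a − c`
    have hac : (0 : ℝ) < a - c := by
      have h1 : (⌈a⌉₊ : ℝ) - 1 < a := by
        have := Nat.ceil_lt_add_one ha.le
        linarith
      have h2 : (c : ℝ) + 1 ≤ ⌈a⌉₊ := by exact_mod_cast hca
      linarith
    -- KEY CLAIM: for `|[B₀]| = c`, `α_{B₀} H^{B₀} ∈ J_{c+1,r}`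
    have key : ∀ B₀ ∈ α.support, bracketDeg p e B₀ = c →
        α B₀ * hPow h B₀ ∈ jIdeal p h e 𝕀 μ a (c + 1) r := by
      intro B₀ hB₀ hdB₀
      have hB₀n : bracketDeg p e B₀ ≤ n := by omega
      have hdegn : (brX p e v B₀).degree ≤ n := by rwa [degree_brX]
      set D := Δ (brX p e v B₀) with hDdef
      set f' := m + α.sum (fun B a => a * hPow h B) with hf'
      -- (i) `D f' − α_{B₀} ∈ U₀ = tail(1, r−c) + 𝔪^{r+1−c}`
      have hi : D f' - α B₀ ∈ tailIdeal p h e 1 (r - c) ⊔ maximalIdeal R ^ (r + 1 - c) := by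
        have hDm : D m ∈ maximalIdeal R ^ (r + 1 - c) := by
          have := hord _ hdegn _ _ hm
          rwa [degree_brX, hdB₀] at this
        have hsum : D (α.sum fun B a => a * hPow h B) - α B₀ =
            ∑ B ∈ α.support, (D (α B * hPow h B) - if B = B₀ then α B else 0) := by
          rw [Finsupp.sum, map_sum, Finset.sum_sub_distrib, Finset.sum_ite_eq' α.support B₀ (fun B => α B),
            if_pos hB₀]
        have e2 : D f' - α B₀ = D m + (D (α.sum fun B a => a * hPow h B) - α B₀) := by
          rw [hf', map_add]; ring
        rw [e2]
        refine add_mem (Ideal.mem_sup_right hDm) ?_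
        rw [hsum]
        refine sum_mem fun B hB => ?_
        have hcB : bracketDeg p e B₀ ≤ bracketDeg p e B := by rw [hdB₀]; exact hαs B hB
        have := apply_mul_hPow_sub_mem p h e x v hp hv hx hh Δ h0 hmul hval hord hB₀n r hcB (hαm B)
        rw [hdB₀] at this
        by_cases hBB : B = B₀
        · subst hBB; simpa using this
        · simpa [hBB] using this
      -- (ii) `D f' ∈ 𝕀_{a−c} ∩ 𝔪^{r−c}` (𝔇-saturation, order drop)
      have hii₁ : D f' ∈ 𝕀.level (a - c) := by
        have := (IdealisticFiltration.isDSaturated_iff k 𝕀).mp hD c D ?_ a f' hf'a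
        · exact this
        · have := hdiff _ hdegn
          rwa [degree_brX, hdB₀] at this
      have hii₂ : D f' ∈ maximalIdeal R ^ (r - c) := by
        have := hord _ hdegn _ _ hf'r
        rwa [degree_brX, hdB₀] at this
      -- (iii) Case 1 at level `a − c`
      have hiii : D f' ∈ jIdeal p h e 𝕀 μ (a - c) 1 (r - c) :=
        level_inf_pow_le_jIdeal_one p h e 𝕀 H hμ0 hμ hac (r - c) ⟨hii₁, hii₂⟩
      -- (iv)/(v): decompose `D f'` and `D f' − α_{B₀}`, and multiply by `H^{B₀} ∈ 𝔪^c`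
      have hHB₀ : hPow h B₀ ∈ maximalIdeal R ^ c := hdB₀ ▸ hPow_mem_pow p h e H.pow_mem B₀
      obtain ⟨y₂, hy₂, t₂, ht₂, hsum₂⟩ := Submodule.mem_sup.mp hiii
      obtain ⟨m₂, hm₂, q₂, hq₂, rfl⟩ := Submodule.mem_sup.mp hy₂
      obtain ⟨t₃, ht₃, m₃, hm₃, hsum₃⟩ := Submodule.mem_sup.mp hi
      have e3 : α B₀ * hPow h B₀ =
          m₂ * hPow h B₀ + q₂ * hPow h B₀ + t₂ * hPow h B₀ - t₃ * hPow h B₀ - m₃ * hPow h B₀ := by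
        have : α B₀ = (m₂ + q₂ + t₂) - (t₃ + m₃) := by rw [hsum₂, hsum₃]; ring
        rw [this]; ring
      rw [e3]
      have hJm : ∀ {m' : R} {j : ℕ}, m' ∈ maximalIdeal R ^ j → r + 1 ≤ j + c →
          m' * hPow h B₀ ∈ jIdeal p h e 𝕀 μ a (c + 1) r := fun hm' hj =>
        Ideal.mem_sup_left (Ideal.mem_sup_left (Ideal.pow_le_pow_right hj (mul_mem_mpow_add hm' hHB₀)))
      have hJq : q₂ * hPow h B₀ ∈ jIdeal p h e 𝕀 μ a (c + 1) r := by
        refine Ideal.mem_sup_left (Ideal.mem_sup_right ?_)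
        have := qIdeal_mul_span_hPow_le p h e 𝕀 μ (a - c) B₀
          (Ideal.mul_mem_mul hq₂ (Ideal.mem_span_singleton_self _))
        rwa [hdB₀, sub_add_cancel] at this
      have hJt : ∀ {t' : R}, t' ∈ tailIdeal p h e 1 (r - c) → t' * hPow h B₀ ∈ jIdeal p h e 𝕀 μ a (c + 1) r :=
        fun ht' => Ideal.mem_sup_right (tailIdeal_mul_span_hPow_le p h e hdB₀ r
          (Ideal.mul_mem_mul ht' (Ideal.mem_span_singleton_self _)))
      exact sub_mem (sub_mem (add_mem (add_mem (hJm hm₂ (by omega)) hJq) (hJt ht₂)) (hJt ht₃))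
        (hJm hm₃ (by omega))
    -- assemble: `m + ∑ α_B H^B ∈ J_{c+1,r}`
    refine add_mem (Ideal.mem_sup_left (Ideal.mem_sup_left hm)) ?_
    rw [Finsupp.sum]
    refine sum_mem fun B hB => ?_
    rcases (hαs B hB).eq_or_lt with hBc | hBc
    · exact key B hB hBc.symm
    · exact Ideal.mem_sup_right (pow_mul_span_le_tailIdeal p h e r (by omega)
        (Ideal.mul_mem_mul (hαm B) (Ideal.mem_span_singleton_self _)))

end StepOneMain


/-! ## The Coefficient Lemma 4.1.4.1 -/

section Main

variable {k : Type*} [Field k] [PerfectField k] {R : Type u} [CommRing R] [IsRegularLocalRing R] [Algebra k R]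
  [Algebra.EssFiniteType k R] [Algebra.FormallySmooth k R]
variable (p : ℕ) [ExpChar R p] {ι : Type*} [Fintype ι] (h : ι → R) (e : ι → ℕ) (𝕀 : IdealisticFiltration R)

/-- **Kawanoue 2007, Lemma 4.1.4.1 (Coefficient Lemma)** — PROVED [arXiv chunk p0091 L4–L10: «Let `μ ∈ ℝ_{≥0}` be
a nonnegative number such that `μ < μ_ℋ(𝕀)`. Set `𝕀'_t = 𝕀_t ∩ 𝔪^{⌈μt⌉}`, where we use the convention that
`𝔪ⁿ = R` for `n ≤ 0`. Then for any `a ∈ ℝ`, we have `𝕀_a = ∑_B 𝕀'_{a−|[B]|} H^B`.»], in Setting 4.1.3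
[p0090 L33 – p0091 L2: `𝕀` 𝔇-saturated; `ℋ = {h_l}` with (i), (ii) of Setting 4.1.1 and (iii) `(h_l, p^{e_l}) ∈ 𝕀`;
`ord_ℋ`, `μ_ℋ(𝕀)`; `[B] = (b_l p^{e_l})`, `|[B]| = ∑ b_l p^{e_l}`]. Typed for a regular local ring `R` which is
essentially of finite type and formally smooth over a perfect field `k` (the printed `R` = localization of a smooth
`k`-algebra at a closed point, `k = k̄`; Hasse–Schmidt operators along a regular system of parameters exist in this
generality, EGA IV₄ 16.11.2), of exponential characteristic `p`; `(h, e)` a weak leading generator system of `𝕀`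
(`IsWeakLGS` = (i) + (ii) at every level + (iii)); `μ_ℋ(𝕀)` = the tree's `muTilde 𝕀 h`; the right-hand side is
`qIdeal p h e 𝕀 μ a = ⨆_B (𝕀_{a−|[B]|} ⊓ 𝔪^{⌈μ(a−|[B]|)⌉₊}) · (H^B)`. Proof = the printed one (Step 1 (⋆)_{c,r} by
induction on `c` — Case 1 through Supporting Lemma 3, Case 2 through `∂_{[B_o]}`, the generalized product rule,
`H^B ≡ X^{[B]}`, Lucas and 𝔇-saturation —, Step 2 the finishing argument); the completion case of the printed `R`
is not covered by these typeclass hypotheses. -- TODO(general form): `R` = completion `Â_𝔫`.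
[cite: Kawanoue2007, Lemma 4.1.4.1] -/
theorem coefficientLemma (hD : 𝕀.IsDSaturated k) (H : IsWeakLGS p 𝕀 h e) {μ : ℝ} (hμ0 : 0 ≤ μ)
    (hμ : ENNReal.ofReal μ < muTilde 𝕀 h) (a : ℝ) :
    𝕀.level a = qIdeal p h e 𝕀 μ a := by
  classical
  rcases le_or_gt a 0 with ha | ha
  · exact level_eq_qIdeal_of_nonpos p h e 𝕀 hμ0 ha
  -- an adapted regular system of parameters (Remark 4.1.1.1 (3))
  obtain ⟨d, x, v, hd, hx, hv, hh⟩ :=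
    exists_rsop_sub_pow_mem p h e H.pow_mem (fun l => (H.pure l).2) H.linearIndependent
  have hxm : ∀ i, x i ∈ maximalIdeal R := fun i => hx ▸ Ideal.subset_span ⟨i, rfl⟩
  -- a truncated Hasse–Schmidt system of level `⌈a⌉₊` along it (EGA IV₄ 16.11.2)
  have hcard : Fintype.card (Fin d) = (maximalIdeal R).spanFinrank := by rw [Fintype.card_fin, hd]
  obtain ⟨Δ, h0, hmul, hval, hdiff⟩ :=
    Resolution.exists_hasseSystem_of_span_eq_maximalIdeal (k := k) x hx hcard ⌈a⌉₊
  have hceil : 1 ≤ ⌈a⌉₊ := Nat.one_le_iff_ne_zero.mpr (Nat.pos_iff_ne_zero.mp (Nat.ceil_pos.mpr ha))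
  refine level_eq_qIdeal_of_forall_le_jIdeal p h e 𝕀 H.level_mem hμ0 fun r => ?_
  exact level_inf_pow_le_jIdeal p h e 𝕀 x v hv hxm hh Δ h0 hmul hval
    (fun q hq => hdiff q.degree q le_rfl hq) hD H hμ0 hμ ⌈a⌉₊ hceil (Nat.le_succ _) a ha le_rfl r

/-- The same for a leading generator system (Def. 3.1.3.1). [cite: Kawanoue2007, Lemma 4.1.4.1] -/
theorem IsLGS.coefficientLemma (hD : 𝕀.IsDSaturated k) (H : IsLGS p 𝕀 h e) {μ : ℝ} (hμ0 : 0 ≤ μ)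
    (hμ : ENNReal.ofReal μ < muTilde 𝕀 h) (a : ℝ) :
    𝕀.level a = qIdeal p h e 𝕀 μ a :=
  Kawanoue2007.coefficientLemma p h e 𝕀 hD H.isWeakLGS hμ0 hμ a

end Main

end Literature.AlgebraicGeometry.Kawanoue2007

end
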